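import Literature.Barriers.ValiantsHypothesis.NotViaSaturationsAlonTarsiProofs
import Mathlib.GroupTheory.Perm.Option
import Mathlib.GroupTheory.Perm.Cycle.Basic
import Mathlib.RingTheory.IntegralDomain
import Mathlib.Algebra.GroupWithZero.Units.Equiv
import HarnessLib

/-!
# Discharge of `Drisko1997_AlonTarsi`: the Alon–Tarsi conjecture in dimension `p + 1`
# (Drisko 1997, Thm. 9)

`Literature.Barriers.ValiantsHypothesis.Drisko1997_AlonTarsi` (file `NotViaSaturationsAlonTarsi.lean`)
is the statement `∀ p, p.Prime → Odd p → AlonTarsiConjecture (p + 1)`: for an odd prime `p` the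
signed count `Σ_L ε(L)` of the Latin squares of order `p + 1` (`ε` = product of the row and column
permutation signs) is nonzero [Drisko1997, abstract and Thm. 9: "the number of even latin squares of
order `n` minus the number of odd latin squares of order `n` is congruent modulo `p³` to
`(−1)^{(p+1)/2} p²`"]. This file proves it (`Drisko1997_AlonTarsi_holds`) together with the printed
congruence (`drisko1997_thm_9`).

## The printed proof and the road taken here

Drisko's proof [Drisko1997, §§2–4]: (Lemma 1) for even `n` the sign is an isotopy invariant;
(Lemma 2, via Sade's divisibility `|A(L)| ∣ n!·n` and `|L·I_n| = (n!)³/|A(L)|`) modulo `p³` only the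
Latin squares whose autotopism group has order divisible by `p` count; (Lemmas 3–4) these are, up
to isotopy, the Cayley tables `L_θ` of the loops of the cyclic neofields based on `ℤ_p`, parametrised
by the orthomorphisms `θ` of `ℤ_p` (`θ` and `θ − id` both permutations, `θ(0) = 0`); (eq. (14)–(16),
Sylow) each such isotopy class has `≡ p² m_L (mod p³)` elements, whence (Thm. 5)
`Σ_L ε(L) ≡ p² Σ_θ ε(L_θ) (mod p³)`; (Lemmas 6–7) `ε(L_θ) = ε(θ) ε(θ^{rc}) = (−1)^{(p−1)/2} ε(θ^{rs})`;
(Lemma 8) the maps `T_g : θ ↦ (i ↦ θ(i+g) − θ(g))` form a group of order `p` acting on the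
orthomorphisms with the multiplications `μ_a`, `a ≠ 0, 1`, as only fixed points, so
`Σ_θ ε(θ) ≡ Σ_{a ≠ 0,1} ε(μ_a) = −1 (mod p)`; (Thm. 9) combine.

We follow this architecture with ONE deviation that shortens the formalisation considerably:
Lemmas 2–4, eq. (14)–(16) and Thm. 5 (isotopy classes, Sade, Sylow, neofields) are replaced by the
elementary orbit count of the TRANSLATION GROUP `G = ℤ_p³` acting on Latin squares of order `p+1`
on the symbol/index set `ℤ_p ⊔ {∞}` by cyclically shifting the finite rows, columns and symbols
(`act`; sign-preserving by Lemma 1 since `p + 1` is even): a non-identity element of `G` fixing a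
Latin square has all three coordinates nonzero (`coords_ne_zero`, pigeonhole), so `G` acts freely
off the set of squares with a nontrivial stabiliser and that part of the sum vanishes modulo
`|G| = p³` (`card_dvd_sum_of_free`, orbit counting); the squares with nontrivial stabiliser split
as `⊔_{b,c ∈ ℤ_p^*} Fix(1,b,c)`, each `Fix(1,b,c) ≅ Fix(1,1,1)` by a multiplier isotopy (`scale`),
and `Fix(1,1,1) = {(0,w,v)·L_θ}` is parametrised by `ℤ_p² × {orthomorphisms}` (`exists_eq_act_LOf`;
this is the content of Drisko's Lemmas 3–4, including "`x₀ = e`" by the same sum argument). Hence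
`Σ_L ε(L) ≡ (p−1)² p² Σ_θ ε(L_θ) (mod p³)` — Drisko's Thm. 5. Lemmas 6–7 become the direct
computation `ε(L_θ) = sgn θ · sgn(θ − id) · sgn(x ↦ −x)` (`signG_LOf`: every finite row, resp.
column, of `L_θ` is a conjugate of one permutation), and Lemma 8 is proved with Drisko's `T_g`-action
for the `T_g`-invariant weight `sgn θ · sgn(θ − id)`, the fixed-point contribution
`Σ_{a ≠ 0,1} χ(a)χ(a−1) = Σ_{b ≠ 0,1} χ(b) = −1` (`χ(a) = sgn(x ↦ ax)`, a nontrivial character of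
`ℤ_p^*` — a generator acts as a `(p−1)`-cycle) replacing the parastrophe bijection `θ ↦ θ^{rs}`.

Everything is elementary (Mathlib: `Perm.sign`, `ZMod p`, cyclicity of `(ZMod p)ˣ`); no new
definitions of `Prop`s, no new named facts (D-0026): net debt `−1`.

## References

* [Drisko1997] A. A. Drisko, *On the number of even and odd Latin squares of order `p+1`*, Adv.
  Math. 128 (1997) 20–35: Lemma 1 (p. 22), Lemmas 2–4 (pp. 24–27), Thm. 5 (p. 30), Lemmas 6–8
  (pp. 31–33), Thm. 9 (p. 33).
* [BurgisserHuttenhainIkenmeyer2017] P. Bürgisser, J. Hüttenhain, C. Ikenmeyer, *Permanent versus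
  determinant: not via saturations*, Proc. AMS 145 (2017), §1.1 (the Alon–Tarsi conjecture and
  Kumar's theorem; `[Dri:98]`).
* [Glynn2010AlonTarsi] D. G. Glynn, SIAM J. Discrete Math. 24 (2010), Cor. 3.4 (even sizes `≤ 24`).
-/

noncomputable section

open Equiv Finset Function

namespace Literature.Barriers.ValiantsHypothesis

open Literature.NumberTheory.DiophantineGeometry Literature.Computability.Complexity

/-! ### Latin squares on an arbitrary finite index type, their sign, isotopies -/

section General

variable {α β : Type*}

/-- Latin squares `M : α → α → α` on an index/symbol type `α`: every row `M i` and every column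
`i ↦ M i j` is a bijection (the tree's `IsLatinSquare` for `α = Fin n`).
[cite: BurgisserHuttenhainIkenmeyer2017, §1.1] -/
def IsLatinG (M : α → α → α) : Prop :=
  (∀ i, Function.Bijective (M i)) ∧ ∀ j, Function.Bijective fun i => M i j

/-- The isotope `(i, j) ↦ τ (M (ρ i) (σ j))` of an array (rows permuted by `ρ`, columns by `σ`,
symbols by `τ`). [cite: Drisko1997, §2 (the action of `I_n = S_n × S_n × S_n`)] -/
def isotope (ρ σ τ : Perm α) (M : α → α → α) : α → α → α := fun i j => τ (M (ρ i) (σ j))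

/-- Unfolding of `isotope`. [cite: Drisko1997, §2 (isotopy, eq. (1))] -/
@[simp] theorem isotope_apply (ρ σ τ : Perm α) (M : α → α → α) (i j : α) :
    isotope ρ σ τ M i j = τ (M (ρ i) (σ j)) := rfl

/-- Isotopies compose. [cite: Drisko1997, §2 (isotopy, eq. (1))] -/
theorem isotope_isotope (ρ σ τ ρ' σ' τ' : Perm α) (M : α → α → α) :
    isotope ρ' σ' τ' (isotope ρ σ τ M) = isotope (ρ'.trans ρ) (σ'.trans σ) (τ.trans τ') M := rfl

/-- The identity isotopy. [cite: Drisko1997, §2 (isotopy, eq. (1))] -/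
theorem isotope_one (M : α → α → α) : isotope 1 1 1 M = M := rfl

/-- An isotope of a Latin square is a Latin square. [cite: Drisko1997, §2 (isotopy, eq. (1))] -/
theorem IsLatinG.isotope {M : α → α → α} (h : IsLatinG M) (ρ σ τ : Perm α) :
    IsLatinG (isotope ρ σ τ M) :=
  ⟨fun i => τ.bijective.comp ((h.1 (ρ i)).comp σ.bijective),
    fun j => τ.bijective.comp ((h.2 (σ j)).comp ρ.bijective)⟩

/-- Isotopy preserves (and reflects) being a Latin square. [cite: Drisko1997, §2 (isotopy, eq. (1))] -/
theorem isLatinG_isotope_iff (ρ σ τ : Perm α) (M : α → α → α) :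
    IsLatinG (isotope ρ σ τ M) ↔ IsLatinG M := by
  refine ⟨fun h => ?_, fun h => h.isotope ρ σ τ⟩
  have h' := h.isotope ρ.symm σ.symm τ.symm
  rwa [isotope_isotope, Equiv.symm_trans_self, Equiv.symm_trans_self, Equiv.self_trans_symm]
    at h'

/-- Relabelling the index/symbol type along `e : α ≃ β`. [folklore] -/
def relabel (e : α ≃ β) (M : α → α → α) : β → β → β := fun i j => e (M (e.symm i) (e.symm j))

/-- A relabelled Latin square is a Latin square. [cite: Drisko1997, §2 (isotopy, eq. (1))] -/
theorem IsLatinG.relabel {M : α → α → α} (h : IsLatinG M) (e : α ≃ β) :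
    IsLatinG (relabel e M) :=
  ⟨fun i => e.bijective.comp ((h.1 (e.symm i)).comp e.symm.bijective),
    fun j => e.bijective.comp ((h.2 (e.symm j)).comp e.symm.bijective)⟩

/-- Relabelling back. [cite: Drisko1997, §2 (isotopy, eq. (1))] -/
theorem relabel_relabel_symm (e : α ≃ β) (M : α → α → α) :
    relabel e.symm (relabel e M) = M := by
  funext i j
  simp [relabel]

/-- Relabelling preserves (and reflects) being a Latin square. [cite: Drisko1997, §2 (isotopy, eq. (1))] -/
theorem isLatinG_relabel_iff (e : α ≃ β) (M : α → α → α) :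
    IsLatinG (relabel e M) ↔ IsLatinG M := by
  refine ⟨fun h => ?_, fun h => h.relabel e⟩
  have h' := h.relabel e.symm
  rwa [relabel_relabel_symm] at h'

variable [Fintype α] [DecidableEq α] [Fintype β] [DecidableEq β]

/-- Being a Latin square is decidable on a finite type. [cite: BurgisserHuttenhainIkenmeyer2017, §1.1] -/
instance isLatinG_decidable : DecidablePred (IsLatinG (α := α)) := fun M => by
  unfold IsLatinG; infer_instance

/-- Row sign `ε_R = ∏_i sgn(M i)`. [cite: Drisko1997, §1 (row sign)] -/
def rowSignG (M : α → α → α) (h : IsLatinG M) : ℤˣ :=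
  ∏ i, Perm.sign (Equiv.ofBijective (M i) (h.1 i))

/-- Column sign `ε_C = ∏_j sgn(i ↦ M i j)`. [cite: Drisko1997, §1 (column sign)] -/
def colSignG (M : α → α → α) (h : IsLatinG M) : ℤˣ :=
  ∏ j, Perm.sign (Equiv.ofBijective (fun i => M i j) (h.2 j))

/-- The sign `ε = ε_R ε_C` of a Latin square, extended by `0` to arbitrary arrays (so that signed
counts are sums over all arrays). [cite: Drisko1997, §1] -/
def signG (M : α → α → α) : ℤ :=
  if h : IsLatinG M then ((rowSignG M h * colSignG M h : ℤˣ) : ℤ) else 0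

/-- The Alon–Tarsi signed count `Σ_L ε(L)` over the Latin squares on `α`. [cite: Drisko1997, Conj. 1] -/
def atCount (α : Type*) [Fintype α] [DecidableEq α] : ℤ :=
  ∑ M : α → α → α, signG M

/-- The extended sign vanishes off the Latin squares. [cite: Drisko1997, §1 (sign of a Latin square)] -/
theorem signG_of_not {M : α → α → α} (h : ¬ IsLatinG M) : signG M = 0 := dif_neg h

/-- The extended sign of a Latin square is `ε_R ε_C`. [cite: Drisko1997, §1 (sign of a Latin square)] -/
theorem signG_of {M : α → α → α} (h : IsLatinG M) :
    signG M = ((rowSignG M h * colSignG M h : ℤˣ) : ℤ) := dif_pos h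

/-- For `α = Fin n` the signed count is the sum defining `AlonTarsiConjecture n` ("the number of even
latin squares of size `n` is different from the number of odd latin squares of size `n`").
[cite: BurgisserHuttenhainIkenmeyer2017, §1.1] -/
theorem atCount_fin (n : ℕ) {hF : Fintype {L : Fin n → Fin n → Fin n // IsLatinSquare L}} :
    atCount (Fin n) =
      ∑ L : {L : Fin n → Fin n → Fin n // IsLatinSquare L}, ((latinSign L.1 L.2 : ℤˣ) : ℤ) := by
  unfold atCount
  rw [← Finset.sum_filter_of_ne (p := fun M : Fin n → Fin n → Fin n => IsLatinG M)
    (fun M _ hM => by by_contra h; exact hM (signG_of_not h))]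
  rw [Finset.sum_subtype (univ.filter fun M : Fin n → Fin n → Fin n => IsLatinG M)
    (p := fun L : Fin n → Fin n → Fin n => IsLatinSquare L)
    (fun M => by rw [Finset.mem_filter]; exact ⟨fun h => h.2, fun h => ⟨mem_univ _, h⟩⟩)]
  refine Finset.sum_congr rfl fun L _ => ?_
  rw [signG_of (show IsLatinG L.1 from L.2)]
  rfl

/-- `sgn(τ ∘ f ∘ σ) = sgn τ · sgn f · sgn σ` for a bijection `f`. [folklore] -/
private theorem sign_ofBijective_eq_conj {g : α → α} (hg : Bijective g) (f : α → α)
    (hf : Bijective f) (σ τ : Perm α) (hfg : ∀ x, g x = τ (f (σ x))) :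
    Perm.sign (Equiv.ofBijective g hg) =
      Perm.sign τ * Perm.sign (Equiv.ofBijective f hf) * Perm.sign σ := by
  rw [← Perm.sign_mul, ← Perm.sign_mul]
  congr 1
  ext x
  exact hfg x

/-- Under an isotopy the row sign changes by `(sgn τ sgn σ)^{|α|}`; for even `|α|` it is invariant.
[cite: Drisko1997, Lemma 1 (proof)] -/
theorem rowSignG_isotope (heven : Even (Fintype.card α)) {M : α → α → α} (h : IsLatinG M)
    (ρ σ τ : Perm α) (h' : IsLatinG (isotope ρ σ τ M)) :
    rowSignG (isotope ρ σ τ M) h' = rowSignG M h := by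
  rw [rowSignG, rowSignG]
  calc (∏ i, Perm.sign (Equiv.ofBijective (isotope ρ σ τ M i) (h'.1 i)))
      = ∏ i, ((Perm.sign τ * Perm.sign σ) *
          Perm.sign (Equiv.ofBijective (M (ρ i)) (h.1 (ρ i)))) := by
        refine Finset.prod_congr rfl fun i _ => ?_
        rw [sign_ofBijective_eq_conj (h'.1 i) (M (ρ i)) (h.1 (ρ i)) σ τ (fun x => rfl)]
        simp only [mul_assoc, mul_comm]
    _ = ∏ i, Perm.sign (Equiv.ofBijective (M (ρ i)) (h.1 (ρ i))) := by
        rw [Finset.prod_mul_distrib, Finset.prod_const, Finset.card_univ,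
          Int.units_pow_eq_pow_mod_two, Nat.even_iff.mp heven, pow_zero, one_mul]
    _ = _ := Fintype.prod_equiv ρ _ _ (fun i => rfl)

/-- Under an isotopy the column sign changes by `(sgn τ sgn ρ)^{|α|}`; for even `|α|` it is
invariant. [cite: Drisko1997, Lemma 1 (proof)] -/
theorem colSignG_isotope (heven : Even (Fintype.card α)) {M : α → α → α} (h : IsLatinG M)
    (ρ σ τ : Perm α) (h' : IsLatinG (isotope ρ σ τ M)) :
    colSignG (isotope ρ σ τ M) h' = colSignG M h := by
  rw [colSignG, colSignG]
  calc (∏ j, Perm.sign (Equiv.ofBijective (fun i => isotope ρ σ τ M i j) (h'.2 j)))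
      = ∏ j, ((Perm.sign τ * Perm.sign ρ) *
          Perm.sign (Equiv.ofBijective (fun i => M i (σ j)) (h.2 (σ j)))) := by
        refine Finset.prod_congr rfl fun j _ => ?_
        rw [sign_ofBijective_eq_conj (h'.2 j) (fun i => M i (σ j)) (h.2 (σ j)) ρ τ (fun x => rfl)]
        simp only [mul_assoc, mul_comm]
    _ = ∏ j, Perm.sign (Equiv.ofBijective (fun i => M i (σ j)) (h.2 (σ j))) := by
        rw [Finset.prod_mul_distrib, Finset.prod_const, Finset.card_univ,
          Int.units_pow_eq_pow_mod_two, Nat.even_iff.mp heven, pow_zero, one_mul]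
    _ = _ := Fintype.prod_equiv σ _ _ (fun j => rfl)

/-- **Drisko's Lemma 1**: for an even size the sign of a Latin square is an isotopy invariant.
[cite: Drisko1997, Lemma 1] -/
theorem signG_isotope (heven : Even (Fintype.card α)) (ρ σ τ : Perm α) (M : α → α → α) :
    signG (isotope ρ σ τ M) = signG M := by
  by_cases h : IsLatinG M
  · have h' := h.isotope ρ σ τ
    rw [signG_of h', signG_of h, rowSignG_isotope heven h ρ σ τ h',
      colSignG_isotope heven h ρ σ τ h']
  · rw [signG_of_not h, signG_of_not (mt (isLatinG_isotope_iff ρ σ τ M).mp h)]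

/-- `sgn(e ∘ f ∘ e⁻¹) = sgn f`. [folklore] -/
private theorem sign_ofBijective_relabel (e : α ≃ β) (f : α → α) (hf : Bijective f)
    {g : β → β} (hg : Bijective g) (hfg : ∀ x, g x = e (f (e.symm x))) :
    Perm.sign (Equiv.ofBijective g hg) = Perm.sign (Equiv.ofBijective f hf) := by
  rw [← Perm.sign_permCongr e (Equiv.ofBijective f hf)]
  congr 1
  ext x
  exact hfg x

/-- The sign is invariant under relabelling the index type (an isotopy onto another symbol set). [cite: Drisko1997, §2 (isotopy, eq. (1))] -/
theorem signG_relabel (e : α ≃ β) (M : α → α → α) : signG (relabel e M) = signG M := by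
  by_cases h : IsLatinG M
  · have h' := h.relabel e
    rw [signG_of h', signG_of h]
    congr 2
    · rw [rowSignG, rowSignG]
      calc (∏ i, Perm.sign (Equiv.ofBijective (relabel e M i) (h'.1 i)))
          = ∏ i, Perm.sign (Equiv.ofBijective (M (e.symm i)) (h.1 (e.symm i))) :=
            Finset.prod_congr rfl fun i _ =>
              sign_ofBijective_relabel e (M (e.symm i)) (h.1 (e.symm i)) (h'.1 i) (fun x => rfl)
        _ = _ := Fintype.prod_equiv e.symm _ _ (fun i => rfl)
    · rw [colSignG, colSignG]
      calc (∏ j, Perm.sign (Equiv.ofBijective (fun i => relabel e M i j) (h'.2 j)))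
          = ∏ j, Perm.sign (Equiv.ofBijective (fun i => M i (e.symm j)) (h.2 (e.symm j))) :=
            Finset.prod_congr rfl fun j _ =>
              sign_ofBijective_relabel e (fun i => M i (e.symm j)) (h.2 (e.symm j)) (h'.2 j)
                (fun x => rfl)
        _ = _ := Fintype.prod_equiv e.symm _ _ (fun j => rfl)
  · rw [signG_of_not h, signG_of_not (mt (isLatinG_relabel_iff e M).mp h)]

/-- The signed count does not depend on the labelling of the index/symbol type ("an `n × n` array of
`n` symbols, which we may take to be `0, 1, …, n−1`"). [cite: Drisko1997, §1 (definition of a latin square and its sign)] -/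
theorem atCount_congr (e : α ≃ β) : atCount α = atCount β := by
  unfold atCount
  refine Fintype.sum_equiv (e.arrowCongr (e.arrowCongr e)) _ _ fun M => ?_
  exact (signG_relabel e M).symm

/-- **Orbit counting for a free action**: if a finite additive group `G` acts on `X`, `S` is an
invariant finite set on which the action is free and `f` is invariant, then `|G| ∣ Σ_{x ∈ S} f x`
(each orbit in `S` has exactly `|G|` elements and `f` is constant on it).
[cite: Drisko1997, §2 (p. 23: "any isotopy class whose cardinality is a multiple of p^k contributes zero")] -/
theorem card_dvd_sum_of_free {G X : Type*} [AddGroup G] [Fintype G] [DecidableEq X]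
    (act : G → X → X) (act_zero : ∀ x, act 0 x = x)
    (act_add : ∀ g h x, act (g + h) x = act g (act h x)) (f : X → ℤ)
    (hf : ∀ g x, f (act g x) = f x) (S : Finset X) (hS : ∀ g, ∀ x ∈ S, act g x ∈ S)
    (hfree : ∀ g, ∀ x ∈ S, act g x = x → g = 0) :
    (Fintype.card G : ℤ) ∣ ∑ x ∈ S, f x := by
  induction S using Finset.strongInduction with
  | H S ih =>
    rcases S.eq_empty_or_nonempty with rfl | ⟨x, hx⟩
    · simp
    · classical
      let O : Finset X := Finset.univ.image fun g => act g x
      have hOS : O ⊆ S := by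
        intro y hy
        obtain ⟨g, -, rfl⟩ := Finset.mem_image.mp hy
        exact hS g x hx
      have hinj : Function.Injective fun g => act g x := by
        intro g h hgh
        have hgh : act g x = act h x := hgh
        have h1 : act (-h + g) x = x := by
          rw [act_add, hgh, ← act_add, neg_add_cancel, act_zero]
        have h2 := hfree _ x hx h1
        rwa [neg_add_eq_zero, eq_comm] at h2
      have hsumO : ∑ y ∈ O, f y = Fintype.card G * f x := by
        rw [Finset.sum_image fun g _ h _ hgh => hinj hgh]
        simp only [hf, Finset.sum_const, Finset.card_univ, nsmul_eq_mul]
      have hne : O.Nonempty := ⟨x, Finset.mem_image.mpr ⟨0, Finset.mem_univ _, act_zero x⟩⟩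
      have hlt : S \ O ⊂ S := Finset.sdiff_ssubset hOS hne
      have hS' : ∀ g, ∀ y ∈ S \ O, act g y ∈ S \ O := by
        intro g y hy
        rw [Finset.mem_sdiff] at hy ⊢
        refine ⟨hS g y hy.1, fun hO => hy.2 ?_⟩
        obtain ⟨g', -, hg'⟩ := Finset.mem_image.mp hO
        have hg' : act g' x = act g y := hg'
        refine Finset.mem_image.mpr ⟨-g + g', Finset.mem_univ _, ?_⟩
        show act (-g + g') x = y
        rw [act_add, hg', ← act_add, neg_add_cancel, act_zero]
      have hfree' : ∀ g, ∀ y ∈ S \ O, act g y = y → g = 0 :=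
        fun g y hy => hfree g y (Finset.sdiff_subset hy)
      have hrec := ih _ hlt hS' hfree'
      rw [← Finset.sum_sdiff hOS, hsumO]
      exact dvd_add hrec (dvd_mul_right _ _)

end General

/-! ### The translation group `ℤ_p³` acting on Latin squares of order `p + 1` -/

section Drisko

variable {p : ℕ} [hp : Fact p.Prime]

/-- The index/symbol set `ℤ_p ⊔ {∞}` of size `p + 1` (`none` is Drisko's extra symbol `e`).
[cite: Drisko1997, §3 (symbol set `{e, 0, 1, …, p−1}`)] -/
abbrev Idx (p : ℕ) : Type := Option (ZMod p)

/-- The cyclic shift by `k` of the finite indices, fixing `∞` (Drisko's `π^k`, `π = (0 1 ⋯ p−1)`).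
[cite: Drisko1997, Lemma 3 (the map "addition of 1")] -/
def sh (k : ZMod p) : Perm (Idx p) := Equiv.optionCongr (Equiv.addRight k)

/-- `π^k` fixes `∞`. [cite: Drisko1997, Lemma 3 (the cycle `π = (0 1 ⋯ p−1)`, "addition of 1")] -/
@[simp] theorem sh_none (k : ZMod p) : sh k none = none := rfl

/-- `π^k` adds `k` to a finite index. [cite: Drisko1997, Lemma 3 (the cycle `π = (0 1 ⋯ p−1)`, "addition of 1")] -/
@[simp] theorem sh_some (k x : ZMod p) : sh k (some x) = some (x + k) := rfl

/-- `π^a π^b = π^{a+b}`. [cite: Drisko1997, Lemma 3 (the cycle `π = (0 1 ⋯ p−1)`, "addition of 1")] -/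
theorem sh_sh (a b : ZMod p) (x : Idx p) : sh a (sh b x) = sh (b + a) x := by
  cases x <;> simp [add_assoc]

/-- `π^0 = 1`. [cite: Drisko1997, Lemma 3 (the cycle `π = (0 1 ⋯ p−1)`, "addition of 1")] -/
theorem sh_zero_apply (x : Idx p) : sh (0 : ZMod p) x = x := by
  cases x <;> simp

/-- `π^a π^b = π^{a+b}` as permutations. [cite: Drisko1997, Lemma 3 (the cycle `π = (0 1 ⋯ p−1)`, "addition of 1")] -/
theorem sh_mul_sh (a b : ZMod p) : sh a * sh b = sh (b + a) := by
  ext x : 1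
  exact sh_sh a b x

/-- `sh k x = x` only for `k = 0` or `x = ∞`. [cite: Drisko1997, Lemma 3 (the cycle `π = (0 1 ⋯ p−1)`, "addition of 1")] -/
theorem sh_eq_self_iff (k : ZMod p) (x : Idx p) : sh k x = x ↔ k = 0 ∨ x = none := by
  cases x with
  | none => simp
  | some y =>
    simp only [sh_some, Option.some.injEq, add_eq_left, reduceCtorEq, or_false]

/-- The translation action of `v = (a, b, c) ∈ ℤ_p³`: shift the finite rows by `a`, the finite
columns by `b` and the finite symbols by `c` (an isotopy). [cite: Drisko1997, §2–3] -/
def act (v : ZMod p × ZMod p × ZMod p) (M : Idx p → Idx p → Idx p) : Idx p → Idx p → Idx p :=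
  isotope (sh (-v.1)) (sh (-v.2.1)) (sh v.2.2) M

/-- Unfolding of the translation action. [cite: Drisko1997, §2 (eq. (1)) and Lemma 3 (the autotopism `(π, π, π)`)] -/
theorem act_apply (v : ZMod p × ZMod p × ZMod p) (M : Idx p → Idx p → Idx p) (i j : Idx p) :
    act v M i j = sh v.2.2 (M (sh (-v.1) i) (sh (-v.2.1) j)) := rfl

/-- The zero translation acts trivially. [cite: Drisko1997, §2 (eq. (1)) and Lemma 3 (the autotopism `(π, π, π)`)] -/
theorem act_zero (M : Idx p → Idx p → Idx p) : act 0 M = M := by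
  funext i j
  simp [act_apply, sh_zero_apply]

/-- The translations form an (additive) group action of `ℤ_p³`. [cite: Drisko1997, §2 (eq. (1)) and Lemma 3 (the autotopism `(π, π, π)`)] -/
theorem act_add (v w : ZMod p × ZMod p × ZMod p) (M : Idx p → Idx p → Idx p) :
    act (v + w) M = act v (act w M) := by
  funext i j
  simp only [act_apply, Prod.fst_add, Prod.snd_add, sh_sh, neg_add, add_comm]

/-- `(−v) · (v · M) = M`. [cite: Drisko1997, §2 (eq. (1)) and Lemma 3 (the autotopism `(π, π, π)`)] -/
theorem act_neg_act (v : ZMod p × ZMod p × ZMod p) (M : Idx p → Idx p → Idx p) :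
    act (-v) (act v M) = M := by
  rw [← act_add, neg_add_cancel, act_zero]

/-- `v · ((−v) · M) = M`. [cite: Drisko1997, §2 (eq. (1)) and Lemma 3 (the autotopism `(π, π, π)`)] -/
theorem act_act_neg (v : ZMod p × ZMod p × ZMod p) (M : Idx p → Idx p → Idx p) :
    act v (act (-v) M) = M := by
  rw [← act_add, add_neg_cancel, act_zero]

/-- The translation group is commutative. [cite: Drisko1997, §2 (eq. (1)) and Lemma 3 (the autotopism `(π, π, π)`)] -/
theorem act_comm (v w : ZMod p × ZMod p × ZMod p) (M : Idx p → Idx p → Idx p) :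
    act v (act w M) = act w (act v M) := by
  rw [← act_add, add_comm, act_add]

/-- Each translation is injective on arrays. [cite: Drisko1997, §2 (eq. (1)) and Lemma 3 (the autotopism `(π, π, π)`)] -/
theorem act_injective (v : ZMod p × ZMod p × ZMod p) :
    Function.Injective (act v : (Idx p → Idx p → Idx p) → _) := by
  intro M N h
  rw [← act_neg_act v M, h, act_neg_act]

/-- Translations preserve (and reflect) being a Latin square. [cite: Drisko1997, §2 (eq. (1)) and Lemma 3 (the autotopism `(π, π, π)`)] -/
theorem isLatinG_act_iff (v : ZMod p × ZMod p × ZMod p) (M : Idx p → Idx p → Idx p) :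
    IsLatinG (act v M) ↔ IsLatinG M :=
  isLatinG_isotope_iff _ _ _ M

/-- `|ℤ_p ⊔ {∞}| = p + 1`. [cite: Drisko1997, §3 (`n = p + 1`, symbol set `{e, 0, 1, …, p−1}`)] -/
private theorem card_idx : Fintype.card (Idx p) = p + 1 := by
  rw [Fintype.card_option, ZMod.card]

/-- The translations preserve the sign (`p + 1` is even). [cite: Drisko1997, Lemma 1] -/
theorem signG_act (hodd : Odd p) (v : ZMod p × ZMod p × ZMod p) (M : Idx p → Idx p → Idx p) :
    signG (act v M) = signG M :=
  signG_isotope (by rw [card_idx]; exact hodd.add_one) _ _ _ M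

/-- `v · M = M` unfolded: `sh c (M i j) = M (sh a i) (sh b j)`. [cite: Drisko1997, §2 (eq. (1)) and Lemma 3 (the autotopism `(π, π, π)`)] -/
theorem act_eq_self_iff (v : ZMod p × ZMod p × ZMod p) (M : Idx p → Idx p → Idx p) :
    act v M = M ↔ ∀ i j, sh v.2.2 (M i j) = M (sh v.1 i) (sh v.2.1 j) := by
  constructor
  · intro h i j
    have h1 := congrFun (congrFun h (sh v.1 i)) (sh v.2.1 j)
    rw [act_apply, sh_sh, sh_sh, add_neg_cancel, add_neg_cancel, sh_zero_apply, sh_zero_apply]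
      at h1
    exact h1
  · intro h
    funext i j
    rw [act_apply, h, sh_sh, sh_sh, neg_add_cancel, neg_add_cancel, sh_zero_apply, sh_zero_apply]

/-- If `v · M = M` then `(n • v) · M = M` (stabilisers are subgroups). [cite: Drisko1997, §2 (the autotopism group `A(L)`)] -/
theorem act_nsmul_eq_self {v : ZMod p × ZMod p × ZMod p} {M : Idx p → Idx p → Idx p}
    (h : act v M = M) (n : ℕ) : act (n • v) M = M := by
  induction n with
  | zero => rw [zero_smul, act_zero]
  | succ n ih => rw [succ_nsmul, act_add, h, ih]

/-- If `v · M = M` then `(k v) · M = M` for `k ∈ ℤ_p` (stabilisers are subgroups). [cite: Drisko1997, §2 (the autotopism group `A(L)`)] -/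
theorem act_smul_eq_self {v : ZMod p × ZMod p × ZMod p} {M : Idx p → Idx p → Idx p}
    (h : act v M = M) (k : ZMod p) : act (k • v) M = M := by
  have hk : k • v = k.val • v := by
    conv_lhs => rw [← ZMod.natCast_zmod_val k]
    exact Nat.cast_smul_eq_nsmul _ _ _
  rw [hk]
  exact act_nsmul_eq_self h _

/-- **The stabilisers of the translation action** (pigeonhole): a nonzero `v = (a, b, c)` fixing a
Latin square has `a, b, c` all nonzero. (A fixing element with a zero coordinate would force a
repeated symbol in the row or column `∞`, or in a finite row/column.) This replaces Drisko's
Lemma 3 "⇒". [cite: Drisko1997, Lemma 3 (proof: an autotopism of order `p` fixes exactly one row, column and symbol)] -/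
theorem coords_ne_zero {v : ZMod p × ZMod p × ZMod p} {M : Idx p → Idx p → Idx p}
    (hM : IsLatinG M) (hv : v ≠ 0) (hfix : act v M = M) :
    v.1 ≠ 0 ∧ v.2.1 ≠ 0 ∧ v.2.2 ≠ 0 := by
  obtain ⟨a, b, c⟩ := v
  rw [act_eq_self_iff] at hfix
  simp only at hfix ⊢
  have h10 : (1 : ZMod p) ≠ 0 := one_ne_zero
  -- `c = 0 → b = 0`: row `∞` would repeat a symbol
  have L1 : c = 0 → b = 0 := by
    intro hc
    have h := hfix none (some 0)
    rw [hc, sh_zero_apply, sh_none, sh_some, zero_add] at h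
    have hinj := (hM.1 none).injective h
    simpa using hinj.symm
  -- `c = 0 → b = 0 → a = 0`: a finite column would repeat a symbol
  have L2 : c = 0 → b = 0 → a = 0 := by
    intro hc hb
    have h := hfix (some 0) (some 0)
    rw [hc, hb, sh_zero_apply, sh_zero_apply, sh_some, zero_add] at h
    have hinj := (hM.2 (some 0)).injective h
    simpa using hinj.symm
  -- `a = 0 → c = 0`: otherwise the column `∞` consists of `∞` only
  have L3 : a = 0 → c = 0 := by
    intro ha
    by_contra hc
    have hcol : ∀ i, M i none = none := by
      intro i
      have h := hfix i none
      rw [ha, sh_zero_apply, sh_none] at h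
      rcases (sh_eq_self_iff c (M i none)).mp h with h' | h'
      · exact absurd h' hc
      · exact h'
    have := (hM.2 none).injective ((hcol none).trans (hcol (some 0)).symm)
    exact (Option.some_ne_none (0 : ZMod p)) this.symm
  -- `b = 0 → c = 0`: otherwise the row `∞` consists of `∞` only
  have L4 : b = 0 → c = 0 := by
    intro hb
    by_contra hc
    have hrow : ∀ j, M none j = none := by
      intro j
      have h := hfix none j
      rw [hb, sh_zero_apply, sh_none] at h
      rcases (sh_eq_self_iff c (M none j)).mp h with h' | h'
      · exact absurd h' hc
      · exact h'
    have := (hM.1 none).injective ((hrow none).trans (hrow (some 0)).symm)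
    exact (Option.some_ne_none (0 : ZMod p)) this.symm
  have hv' : ¬ (a = 0 ∧ b = 0 ∧ c = 0) := by
    rintro ⟨rfl, rfl, rfl⟩
    exact hv rfl
  refine ⟨fun ha => hv' ⟨ha, L1 (L3 ha), L3 ha⟩, fun hb => hv' ⟨L2 (L4 hb) hb, hb, L4 hb⟩,
    fun hc => hv' ⟨L2 hc (L1 hc), L1 hc, hc⟩⟩

/-! ### Splitting the signed count: free part and the fixed sets `Fix(1,b,c)` -/

open scoped Classical in
/-- Latin squares on which the translation group acts freely (Drisko: autotopism group of order prime to `p`). [cite: Drisko1997, Lemma 2] -/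
def freeSet (p : ℕ) [Fact p.Prime] : Finset (Idx p → Idx p → Idx p) :=
  univ.filter fun M => IsLatinG M ∧ ∀ v, act v M = M → v = 0

open scoped Classical in
/-- Latin squares with a nontrivial stabiliser in the translation group (Drisko: autotopism group of
order divisible by `p`). [cite: Drisko1997, Lemma 2] -/
def symSet (p : ℕ) [Fact p.Prime] : Finset (Idx p → Idx p → Idx p) :=
  univ.filter fun M => IsLatinG M ∧ ∃ v, v ≠ 0 ∧ act v M = M

open scoped Classical in
/-- `Fix(v)`: the Latin squares fixed by the translation `v`. [cite: Drisko1997, Lemma 3] -/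
def fixSet (v : ZMod p × ZMod p × ZMod p) : Finset (Idx p → Idx p → Idx p) :=
  univ.filter fun M => IsLatinG M ∧ act v M = M

/-- Membership in the free part. [cite: Drisko1997, Lemma 2] -/
theorem mem_freeSet {M : Idx p → Idx p → Idx p} :
    M ∈ freeSet p ↔ IsLatinG M ∧ ∀ v, act v M = M → v = 0 := by
  classical
  simp [freeSet]

/-- Membership in the symmetric part. [cite: Drisko1997, Lemma 2] -/
theorem mem_symSet {M : Idx p → Idx p → Idx p} :
    M ∈ symSet p ↔ IsLatinG M ∧ ∃ v, v ≠ 0 ∧ act v M = M := by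
  classical
  simp [symSet]

/-- Membership in `Fix(v)`. [cite: Drisko1997, Lemma 2] -/
theorem mem_fixSet {v : ZMod p × ZMod p × ZMod p} {M : Idx p → Idx p → Idx p} :
    M ∈ fixSet v ↔ IsLatinG M ∧ act v M = M := by
  classical
  simp [fixSet]

/-- `Σ_M ε(M) = Σ_{free} ε + Σ_{sym} ε`. [cite: Drisko1997, Lemma 2] -/
theorem atCount_idx_eq : atCount (Idx p) = ∑ M ∈ freeSet p, signG M + ∑ M ∈ symSet p, signG M := by
  classical
  unfold atCount
  rw [← Finset.sum_filter_of_ne (p := fun M : Idx p → Idx p → Idx p => IsLatinG M)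
    (fun M _ hM => by by_contra h; exact hM (signG_of_not h))]
  rw [← Finset.sum_filter_add_sum_filter_not (univ.filter fun M : Idx p → Idx p → Idx p =>
    IsLatinG M) (fun M => ∀ v, act v M = M → v = 0)]
  congr 1
  · refine Finset.sum_congr ?_ fun _ _ => rfl
    ext M
    simp only [Finset.mem_filter, Finset.mem_univ, true_and, mem_freeSet]
  · refine Finset.sum_congr ?_ fun _ _ => rfl
    ext M
    simp only [Finset.mem_filter, Finset.mem_univ, true_and, mem_symSet, not_forall,
      exists_prop]
    exact ⟨fun ⟨h1, v, h2, h3⟩ => ⟨h1, v, h3, h2⟩, fun ⟨h1, v, h2, h3⟩ => ⟨h1, v, h3, h2⟩⟩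

/-- **The free part vanishes modulo `p³`** (Drisko's Lemma 2, by orbit counting for the translation
group). [cite: Drisko1997, Lemma 2] -/
theorem pow_three_dvd_sum_freeSet (hodd : Odd p) :
    ((p : ℤ) ^ 3) ∣ ∑ M ∈ freeSet p, signG M := by
  have hcard : Fintype.card (ZMod p × ZMod p × ZMod p) = p ^ 3 := by
    simp only [Fintype.card_prod, ZMod.card]; ring
  have h := card_dvd_sum_of_free (G := ZMod p × ZMod p × ZMod p) act act_zero act_add signG
    (signG_act hodd) (freeSet p) ?_ ?_
  · rwa [hcard, Nat.cast_pow] at h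
  · intro g M hM
    rw [mem_freeSet] at hM ⊢
    refine ⟨(isLatinG_act_iff g M).mpr hM.1, fun v hv => hM.2 v ?_⟩
    rw [act_comm] at hv
    exact act_injective g hv
  · intro g M hM hg
    exact (mem_freeSet.mp hM).2 g hg

/-- The nonzero elements of `ℤ_p`. [cite: Drisko1997, §3 (p. 29, the isotopisms `(μ_r, μ_r, μ_r)`, `r ∈ ℤ_p ∖ {0}`)] -/
def nz (p : ℕ) [Fact p.Prime] : Finset (ZMod p) := univ.filter fun a => a ≠ 0

/-- Membership in `ℤ_p ∖ {0}`. [cite: Drisko1997, §3 (p. 29, the isotopisms `(μ_r, μ_r, μ_r)`, `r ∈ ℤ_p ∖ {0}`)] -/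
theorem mem_nz {a : ZMod p} : a ∈ nz p ↔ a ≠ 0 := by simp [nz]

/-- `|ℤ_p ∖ {0}| = p − 1`. [cite: Drisko1997, §3 (p. 29, the isotopisms `(μ_r, μ_r, μ_r)`, `r ∈ ℤ_p ∖ {0}`)] -/
theorem card_nz : (nz p).card = p - 1 := by
  rw [nz, Finset.filter_ne' univ (0 : ZMod p), Finset.card_erase_of_mem (mem_univ _),
    Finset.card_univ, ZMod.card]

/-- `sym = ⊔_{b,c ≠ 0} Fix(1,b,c)` (every nontrivial stabiliser is generated by a unique `(1,b,c)`).
[cite: Drisko1997, Lemma 3 and eq. (9) (an autotopism of order `p` permutes rows, columns and symbols alike)] -/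
theorem symSet_eq_biUnion :
    symSet p = (nz p ×ˢ nz p).biUnion fun bc => fixSet ((1 : ZMod p), bc.1, bc.2) := by
  ext M
  rw [mem_symSet, Finset.mem_biUnion]
  constructor
  · rintro ⟨hM, v, hv, hfix⟩
    obtain ⟨ha, hb, hc⟩ := coords_ne_zero hM hv hfix
    refine ⟨(v.1⁻¹ * v.2.1, v.1⁻¹ * v.2.2), ?_, ?_⟩
    · rw [Finset.mem_product, mem_nz, mem_nz]
      exact ⟨mul_ne_zero (inv_ne_zero ha) hb, mul_ne_zero (inv_ne_zero ha) hc⟩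
    · rw [mem_fixSet]
      refine ⟨hM, ?_⟩
      have h := act_smul_eq_self hfix v.1⁻¹
      have hv' : v.1⁻¹ • v = ((1 : ZMod p), v.1⁻¹ * v.2.1, v.1⁻¹ * v.2.2) := by
        ext <;> simp [inv_mul_cancel₀ ha]
      rwa [hv'] at h
  · rintro ⟨bc, -, hM⟩
    rw [mem_fixSet] at hM
    refine ⟨hM.1, _, ?_, hM.2⟩
    intro h0
    have h1 := congrArg Prod.fst h0
    exact one_ne_zero h1

/-- Stabilisers are subgroups: `v, w ∈ Stab ⇒ v − w ∈ Stab`. [cite: Drisko1997, §2 (the autotopism group `A(L)`)] -/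
theorem act_sub_eq_self {v w : ZMod p × ZMod p × ZMod p} {M : Idx p → Idx p → Idx p}
    (hv : act v M = M) (hw : act w M = M) : act (v - w) M = M := by
  have hw' : act (-w) M = M := by
    conv_lhs => rw [← hw]
    rw [act_neg_act]
  rw [sub_eq_add_neg, act_add, hw', hv]

/-- The sets `Fix(1,b,c)`, `(b,c) ∈ (ℤ_p^*)²`, are pairwise disjoint (a stabiliser contains no element with a zero coordinate). [cite: Drisko1997, Lemma 3] -/
theorem fixSet_pairwiseDisjoint :
    ((nz p ×ˢ nz p : Finset (ZMod p × ZMod p)) : Set (ZMod p × ZMod p)).PairwiseDisjoint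
      fun bc => fixSet ((1 : ZMod p), bc.1, bc.2) := by
  intro bc _ bc' _ hne
  rw [Function.onFun, Finset.disjoint_left]
  intro M hM hM'
  rw [mem_fixSet] at hM hM'
  apply hne
  have hsub := act_sub_eq_self hM.2 hM'.2
  by_contra hne'
  have hv : ((1 : ZMod p), bc.1, bc.2) - ((1 : ZMod p), bc'.1, bc'.2) ≠ 0 := by
    intro h0
    apply hne'
    have h2 := congrArg (fun v => v.2.1) h0
    have h3 := congrArg (fun v => v.2.2) h0
    simp only [Prod.snd_sub, Prod.fst_sub, Prod.snd_zero, Prod.fst_zero, sub_eq_zero] at h2 h3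
    exact Prod.ext h2 h3
  have h := (coords_ne_zero hM.1 hv hsub).1
  simp at h

/-- `Σ_{sym} ε = Σ_{b ≠ 0} Σ_{c ≠ 0} Σ_{Fix(1,b,c)} ε`. [cite: Drisko1997, Lemma 3] -/
theorem sum_symSet_eq :
    ∑ M ∈ symSet p, signG M =
      ∑ bc ∈ nz p ×ˢ nz p, ∑ M ∈ fixSet ((1 : ZMod p), bc.1, bc.2), signG M := by
  rw [symSet_eq_biUnion, Finset.sum_biUnion fixSet_pairwiseDisjoint]

/-! ### `Fix(1,b,c) ≅ Fix(1,1,1)` by a multiplier isotopy -/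

/-- Multiplication of the finite indices by a unit, fixing `∞` (Drisko's `μ_r`).
[cite: Drisko1997, §3 (the isotopisms `(μ_r, μ_r, μ_r)`, p. 29)] -/
def mulPerm (u : (ZMod p)ˣ) : Perm (Idx p) := Equiv.optionCongr u.mulLeft

/-- `μ_u` fixes `∞`. [cite: Drisko1997, §3 (p. 29, the isotopisms `(μ_r, μ_r, μ_r)`, `r ∈ ℤ_p ∖ {0}`)] -/
@[simp] theorem mulPerm_none (u : (ZMod p)ˣ) : mulPerm u none = none := rfl

/-- `μ_u` multiplies a finite index by `u`. [cite: Drisko1997, §3 (p. 29, the isotopisms `(μ_r, μ_r, μ_r)`, `r ∈ ℤ_p ∖ {0}`)] -/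
@[simp] theorem mulPerm_some (u : (ZMod p)ˣ) (x : ZMod p) :
    mulPerm u (some x) = some ((u : ZMod p) * x) := rfl

/-- The multiplier isotopy: columns scaled by `u`, symbols by `w`. [cite: Drisko1997, §3 (p. 29, the isotopisms `(μ_r, μ_r, μ_r)`, `r ∈ ℤ_p ∖ {0}`)] -/
def scale (u w : (ZMod p)ˣ) (M : Idx p → Idx p → Idx p) : Idx p → Idx p → Idx p :=
  isotope 1 (mulPerm u) (mulPerm w) M

/-- Unfolding of the multiplier isotopy. [cite: Drisko1997, §3 (p. 29, the isotopisms `(μ_r, μ_r, μ_r)`, `r ∈ ℤ_p ∖ {0}`)] -/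
theorem scale_apply (u w : (ZMod p)ˣ) (M : Idx p → Idx p → Idx p) (i j : Idx p) :
    scale u w M i j = mulPerm w (M i (mulPerm u j)) := rfl

/-- `μ_u π^k = π^{uk} μ_u`. [cite: Drisko1997, §3 (p. 29, the isotopisms `(μ_r, μ_r, μ_r)`, `r ∈ ℤ_p ∖ {0}`)] -/
theorem mulPerm_sh (u : (ZMod p)ˣ) (k : ZMod p) (x : Idx p) :
    mulPerm u (sh k x) = sh ((u : ZMod p) * k) (mulPerm u x) := by
  cases x <;> simp [mul_add]

/-- `π^k μ_w = μ_w π^{w⁻¹k}`. [cite: Drisko1997, §3 (p. 29, the isotopisms `(μ_r, μ_r, μ_r)`, `r ∈ ℤ_p ∖ {0}`)] -/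
theorem sh_mulPerm (w : (ZMod p)ˣ) (k : ZMod p) (x : Idx p) :
    sh k (mulPerm w x) = mulPerm w (sh (((w⁻¹ : (ZMod p)ˣ) : ZMod p) * k) x) := by
  cases x with
  | none => rfl
  | some y => simp only [mulPerm_some, sh_some, mul_add, Units.mul_inv_cancel_left]

/-- `μ_u μ_w = μ_{uw}`. [cite: Drisko1997, §3 (p. 29, the isotopisms `(μ_r, μ_r, μ_r)`, `r ∈ ℤ_p ∖ {0}`)] -/
theorem mulPerm_mulPerm (u w : (ZMod p)ˣ) (x : Idx p) :
    mulPerm u (mulPerm w x) = mulPerm (u * w) x := by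
  cases x <;> simp [mul_assoc]

/-- `μ_1 = 1`. [cite: Drisko1997, §3 (p. 29, the isotopisms `(μ_r, μ_r, μ_r)`, `r ∈ ℤ_p ∖ {0}`)] -/
theorem mulPerm_one (x : Idx p) : mulPerm (1 : (ZMod p)ˣ) x = x := by
  cases x <;> simp

/-- Equivariance: `v · (scale u w M) = scale u w ((a, u b, w⁻¹ c) · M)` (the multipliers normalise the translations). [cite: Drisko1997, §3 (p. 29, the isotopisms `(μ_r, μ_r, μ_r)`, `r ∈ ℤ_p ∖ {0}`)] -/
theorem act_scale (v : ZMod p × ZMod p × ZMod p) (u w : (ZMod p)ˣ) (M : Idx p → Idx p → Idx p) :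
    act v (scale u w M) =
      scale u w (act (v.1, (u : ZMod p) * v.2.1, ((w⁻¹ : (ZMod p)ˣ) : ZMod p) * v.2.2) M) := by
  funext i j
  simp only [act_apply, scale_apply]
  rw [mulPerm_sh, sh_mulPerm, mul_neg]

/-- The multiplier isotopies by `(u, w)` and `(u⁻¹, w⁻¹)` are inverse. [cite: Drisko1997, §3 (p. 29, the isotopisms `(μ_r, μ_r, μ_r)`, `r ∈ ℤ_p ∖ {0}`)] -/
theorem scale_scale_inv (u w : (ZMod p)ˣ) (M : Idx p → Idx p → Idx p) :
    scale u w (scale u⁻¹ w⁻¹ M) = M := by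
  funext i j
  rw [scale_apply, scale_apply, mulPerm_mulPerm, mulPerm_mulPerm, mul_inv_cancel, inv_mul_cancel,
    mulPerm_one, mulPerm_one]

/-- The multiplier isotopies by `(u⁻¹, w⁻¹)` and `(u, w)` are inverse. [cite: Drisko1997, §3 (p. 29, the isotopisms `(μ_r, μ_r, μ_r)`, `r ∈ ℤ_p ∖ {0}`)] -/
theorem scale_inv_scale (u w : (ZMod p)ˣ) (M : Idx p → Idx p → Idx p) :
    scale u⁻¹ w⁻¹ (scale u w M) = M := by
  have h := scale_scale_inv u⁻¹ w⁻¹ M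
  rwa [inv_inv, inv_inv] at h

/-- Multiplier isotopies preserve (and reflect) being a Latin square. [cite: Drisko1997, §3 (p. 29, the isotopisms `(μ_r, μ_r, μ_r)`, `r ∈ ℤ_p ∖ {0}`)] -/
theorem isLatinG_scale_iff (u w : (ZMod p)ˣ) (M : Idx p → Idx p → Idx p) :
    IsLatinG (scale u w M) ↔ IsLatinG M :=
  isLatinG_isotope_iff _ _ _ M

/-- Multiplier isotopies preserve the sign (`p + 1` even). [cite: Drisko1997, Lemma 1] -/
theorem signG_scale (hodd : Odd p) (u w : (ZMod p)ˣ) (M : Idx p → Idx p → Idx p) :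
    signG (scale u w M) = signG M :=
  signG_isotope (by rw [card_idx]; exact hodd.add_one) _ _ _ M

/-- **`Fix(1,b,c) ≅ Fix(1,1,1)` preserving signs**, for `b, c ≠ 0` (scale the columns by `b` and
the symbols by `c⁻¹`). [cite: Drisko1997, Lemma 3 (proof, last isotopism) and Lemma 1] -/
theorem sum_fixSet_eq_sum_fixSet_one (hodd : Odd p) {b c : ZMod p} (hb : b ≠ 0) (hc : c ≠ 0) :
    ∑ M ∈ fixSet ((1 : ZMod p), b, c), signG M = ∑ M ∈ fixSet ((1 : ZMod p), 1, 1), signG M := by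
  set u : (ZMod p)ˣ := Units.mk0 b hb with hu
  set w : (ZMod p)ˣ := (Units.mk0 c hc)⁻¹ with hw
  refine Finset.sum_nbij' (scale u w) (scale u⁻¹ w⁻¹) ?_ ?_ ?_ ?_ ?_
  · intro M hM
    rw [mem_fixSet] at hM ⊢
    refine ⟨(isLatinG_scale_iff u w M).mpr hM.1, ?_⟩
    rw [act_scale]
    simp only [hu, hw, inv_inv, Units.val_mk0, mul_one]
    rw [hM.2]
  · intro M hM
    rw [mem_fixSet] at hM ⊢
    refine ⟨(isLatinG_scale_iff _ _ M).mpr hM.1, ?_⟩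
    rw [act_scale]
    simp only [hu, hw, inv_inv, Units.val_inv_eq_inv_val, Units.val_mk0, inv_mul_cancel₀ hb,
      inv_inv, inv_mul_cancel₀ hc]
    rw [hM.2]
  · intro M _
    exact scale_inv_scale u w M
  · intro M _
    exact scale_scale_inv u w M
  · intro M _
    exact (signG_scale hodd u w M).symm

end Drisko

/-! ### Orthomorphisms of `ℤ_p` and the squares `L_θ` (Drisko's Lemma 4 and the table on p. 26) -/

section Orth

variable {p : ℕ} [hp : Fact p.Prime]

/-- The orthomorphisms of `ℤ_p`: permutations `θ` with `θ(0) = 0` such that `θ − id` is again a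
permutation; packaged as the pair `(θ, θ − id)` of permutations. [cite: Drisko1997, §3 (p. 27, "An orthomorphism θ of an abelian group")] -/
def Orth (p : ℕ) [Fact p.Prime] : Type :=
  {θ : Perm (ZMod p) × Perm (ZMod p) // θ.1 0 = 0 ∧ ∀ x, θ.2 x = θ.1 x - x}

/-- The orthomorphisms of `ℤ_p` form a finite set. [cite: Drisko1997, §3 (p. 27, orthomorphisms of `ℤ_p`)] -/
instance Orth.instFintype : Fintype (Orth p) := by unfold Orth; infer_instance

/-- Equality of orthomorphisms is decidable. [cite: Drisko1997, §3 (p. 27, orthomorphisms of `ℤ_p`)] -/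
instance Orth.instDecidableEq : DecidableEq (Orth p) := by unfold Orth; infer_instance

namespace Orth

variable (θ : Orth p)

/-- The permutation `θ`. [cite: Drisko1997, §3 (p. 27, orthomorphisms of `ℤ_p`)] -/
def perm : Perm (ZMod p) := θ.1.1

/-- The permutation `θ − id`. [cite: Drisko1997, §3 (p. 27, orthomorphisms of `ℤ_p`)] -/
def eta : Perm (ZMod p) := θ.1.2

/-- `θ(0) = 0`. [cite: Drisko1997, §3 (p. 27, orthomorphisms of `ℤ_p`)] -/
theorem perm_zero : θ.perm 0 = 0 := θ.2.1

/-- `(θ − id)(x) = θ(x) − x`. [cite: Drisko1997, §3 (p. 27, orthomorphisms of `ℤ_p`)] -/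
theorem eta_apply (x : ZMod p) : θ.eta x = θ.perm x - x := θ.2.2 x

/-- `(θ − id)(0) = 0`. [cite: Drisko1997, §3 (p. 27, orthomorphisms of `ℤ_p`)] -/
theorem eta_zero : θ.eta 0 = 0 := by rw [eta_apply, perm_zero, sub_zero]

/-- `θ(x) ≠ 0` for `x ≠ 0`. [cite: Drisko1997, §3 (p. 27, orthomorphisms of `ℤ_p`)] -/
theorem perm_ne_zero {x : ZMod p} (hx : x ≠ 0) : θ.perm x ≠ 0 :=
  fun h => hx (θ.perm.injective (h.trans θ.perm_zero.symm))

/-- `θ(x) ≠ x` for `x ≠ 0`. [cite: Drisko1997, §3 (p. 27, orthomorphisms of `ℤ_p`)] -/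
theorem eta_ne_zero {x : ZMod p} (hx : x ≠ 0) : θ.eta x ≠ 0 :=
  fun h => hx (θ.eta.injective (h.trans θ.eta_zero.symm))

/-- An orthomorphism is determined by its permutation `θ`. [cite: Drisko1997, §3 (p. 27, orthomorphisms of `ℤ_p`)] -/
theorem ext' {θ θ' : Orth p} (h : ∀ x, θ.perm x = θ'.perm x) : θ = θ' := by
  apply Subtype.ext
  refine Prod.ext (Equiv.ext h) (Equiv.ext fun x => ?_)
  change θ.eta x = θ'.eta x
  rw [eta_apply, eta_apply, h]

end Orth

/-- The Latin square `L_θ` of an orthomorphism (the Cayley table of the loop of the cyclic neofield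
determined by `θ`): row `∞` and column `∞` in order, `∞` on the finite diagonal, and
`L_θ(r, x) = θ(x − r) + r` for finite `x ≠ r` (Drisko's table, p. 26, with `x_i = θ(i)`).
[cite: Drisko1997, §3 (table after Lemma 3) and Lemma 4] -/
def LOf (θ : Orth p) : Idx p → Idx p → Idx p
  | none, j => j
  | some r, none => some r
  | some r, some x => if x = r then none else some (θ.perm (x - r) + r)

variable (θ : Orth p)

/-- Row `∞` of `L_θ` is in order. [cite: Drisko1997, §3 (the table after Lemma 3, p. 26) and Lemma 4] -/
@[simp] theorem LOf_none (j : Idx p) : LOf θ none j = j := by cases j <;> rfl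

/-- Column `∞` of `L_θ` is in order. [cite: Drisko1997, §3 (the table after Lemma 3, p. 26) and Lemma 4] -/
@[simp] theorem LOf_some_none (r : ZMod p) : LOf θ (some r) none = some r := rfl

/-- The finite part of `L_θ`: `∞` on the diagonal, `θ(x − r) + r` off it. [cite: Drisko1997, §3 (the table after Lemma 3, p. 26) and Lemma 4] -/
theorem LOf_some_some (r x : ZMod p) :
    LOf θ (some r) (some x) = if x = r then none else some (θ.perm (x - r) + r) := rfl

/-- The finite row `0` of `L_θ` as a permutation: `(∞ 0) ∘ θ`. [cite: Drisko1997, Lemma 6 (proof, eq. (19))] -/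
def rowBase : Perm (Idx p) := Equiv.swap none (some 0) * Equiv.optionCongr θ.perm

/-- The finite column `0` of `L_θ` as a permutation: `(∞ 0) ∘ (θ − id) ∘ (x ↦ −x)`.
[cite: Drisko1997, Lemma 7 (proof: `(−i)θ^{rc} = iθ − i`)] -/
def colBase : Perm (Idx p) :=
  Equiv.swap none (some 0) * Equiv.optionCongr ((Equiv.neg (ZMod p)).trans θ.eta)

/-- Row `0` of `L_θ` is the permutation `(∞ 0) ∘ θ`. [cite: Drisko1997, Lemma 6 (proof)] -/
theorem LOf_some_zero (j : Idx p) : LOf θ (some 0) j = rowBase θ j := by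
  cases j with
  | none => simp [rowBase]
  | some x =>
    rw [LOf_some_some, rowBase, Perm.mul_apply, Equiv.optionCongr_apply, Option.map_some, sub_zero,
      add_zero]
    by_cases hx : x = 0
    · rw [if_pos hx, hx, θ.perm_zero, Equiv.swap_apply_right]
    · rw [if_neg hx, Equiv.swap_apply_of_ne_of_ne (Option.some_ne_none _)
        (fun h => θ.perm_ne_zero hx (Option.some_injective _ h))]

/-- Column `0` of `L_θ` is the permutation `(∞ 0) ∘ (θ − id) ∘ (x ↦ −x)`. [cite: Drisko1997, Lemma 7 (proof)] -/
theorem LOf_zero_col (i : Idx p) : LOf θ i (some 0) = colBase θ i := by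
  cases i with
  | none => simp [colBase]
  | some r =>
    rw [LOf_some_some, colBase, Perm.mul_apply, Equiv.optionCongr_apply, Option.map_some,
      Equiv.trans_apply, Equiv.neg_apply, θ.eta_apply, sub_neg_eq_add, zero_sub]
    by_cases hr : r = 0
    · rw [if_pos hr.symm, hr, neg_zero, θ.perm_zero, zero_add, Equiv.swap_apply_right]
    · rw [if_neg (Ne.symm hr), Equiv.swap_apply_of_ne_of_ne (Option.some_ne_none _) ?_]
      intro h
      have h' := Option.some_injective _ h
      rw [← sub_neg_eq_add, ← θ.eta_apply] at h'
      exact θ.eta_ne_zero (neg_ne_zero.mpr hr) h'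

/-- Every finite row of `L_θ` is a conjugate of row `0` by a shift. [cite: Drisko1997, Lemma 6 (proof)] -/
theorem LOf_row (r : ZMod p) (j : Idx p) :
    LOf θ (some r) j = (sh r * rowBase θ * sh (-r)) j := by
  rw [Perm.mul_apply, Perm.mul_apply, ← LOf_some_zero]
  cases j with
  | none => simp
  | some x =>
    rw [sh_some, LOf_some_some, LOf_some_some, ← sub_eq_add_neg, sub_zero, add_zero]
    by_cases hx : x = r
    · rw [if_pos hx, if_pos (sub_eq_zero.mpr hx), sh_none]
    · rw [if_neg hx, if_neg (sub_ne_zero.mpr hx), sh_some]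

/-- Every finite column of `L_θ` is a conjugate of column `0` by a shift. [cite: Drisko1997, Lemma 6 (proof)] -/
theorem LOf_col (x : ZMod p) (i : Idx p) :
    LOf θ i (some x) = (sh x * colBase θ * sh (-x)) i := by
  rw [Perm.mul_apply, Perm.mul_apply, ← LOf_zero_col]
  cases i with
  | none => simp
  | some r =>
    rw [sh_some, LOf_some_some, LOf_some_some]
    by_cases hx : x = r
    · rw [if_pos hx, if_pos (by rw [hx, add_neg_cancel]), sh_none]
    · have h' : ¬ (0 : ZMod p) = r + -x := by
        rw [← sub_eq_add_neg, eq_comm, sub_eq_zero]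
        exact Ne.symm hx
      rw [if_neg hx, if_neg h', sh_some, Option.some.injEq]
      have e : (0 : ZMod p) - (r + -x) = x - r := by ring
      rw [e]
      ring

/-- `L_θ` is a Latin square. [cite: Drisko1997, Lemma 4] -/
theorem isLatinG_LOf : IsLatinG (LOf θ) := by
  refine ⟨fun i => ?_, fun j => ?_⟩
  · cases i with
    | none =>
      have h : LOf θ none = id := funext (LOf_none θ)
      rw [h]
      exact Function.bijective_id
    | some r =>
      have h : LOf θ (some r) = ⇑(sh r * rowBase θ * sh (-r)) := funext (LOf_row θ r)
      rw [h]
      exact Equiv.bijective _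
  · cases j with
    | none =>
      have h : (fun i => LOf θ i none) = id := by
        funext i; cases i <;> rfl
      rw [h]
      exact Function.bijective_id
    | some x =>
      have h : (fun i => LOf θ i (some x)) = ⇑(sh x * colBase θ * sh (-x)) := funext (LOf_col θ x)
      rw [h]
      exact Equiv.bijective _

/-- `π^0 = 1` as a permutation. [cite: Drisko1997, Lemma 3 (the cycle `π = (0 1 ⋯ p−1)`, "addition of 1")] -/
theorem sh_zero : sh (0 : ZMod p) = 1 := Equiv.ext sh_zero_apply

/-- `sgn(π^r) sgn(π^{−r}) = 1`. [cite: Drisko1997, Lemma 3 (the cycle `π = (0 1 ⋯ p−1)`, "addition of 1")] -/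
theorem sign_sh_mul_sign_sh_neg (r : ZMod p) : Perm.sign (sh r) * Perm.sign (sh (-r)) = 1 := by
  rw [← Perm.sign_mul, sh_mul_sh, neg_add_cancel, sh_zero, Perm.sign_one]

/-- `sgn((∞ 0) ∘ θ) = −sgn θ` ("the sign of row `i` is `ε(e i) ε(φ_i) = −ε(φ_i)`"). [cite: Drisko1997, Lemma 6 (eq. (19))] -/
theorem sign_rowBase : Perm.sign (rowBase θ) = -Perm.sign θ.perm := by
  rw [rowBase, Perm.sign_mul, Perm.sign_swap (Option.some_ne_none (0 : ZMod p)).symm,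
    Equiv.optionCongr_sign, neg_one_mul]

/-- `sgn((∞ 0) ∘ (θ − id) ∘ (−)) = −sgn(θ − id) sgn(x ↦ −x)`. [cite: Drisko1997, Lemma 6 and Lemma 7 (proof)] -/
theorem sign_colBase :
    Perm.sign (colBase θ) = -(Perm.sign θ.eta * Perm.sign (Equiv.neg (ZMod p))) := by
  rw [colBase, Perm.sign_mul, Perm.sign_swap (Option.some_ne_none (0 : ZMod p)).symm,
    Equiv.optionCongr_sign, Perm.sign_trans, neg_one_mul]

/-- **Lemma 6 (rows)**: `ε_R(L_θ) = −sgn θ`. [cite: Drisko1997, Lemma 6] -/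
theorem rowSignG_LOf (hodd : Odd p) (h : IsLatinG (LOf θ)) : rowSignG (LOf θ) h = -Perm.sign θ.perm := by
  rw [rowSignG, Fintype.prod_option]
  have h1 : (Equiv.ofBijective (LOf θ none) (h.1 none) : Perm (Idx p)) = 1 :=
    Equiv.ext fun j => LOf_none θ j
  have h2 : ∀ r : ZMod p, (Equiv.ofBijective (LOf θ (some r)) (h.1 (some r)) : Perm (Idx p)) =
      sh r * rowBase θ * sh (-r) := fun r => Equiv.ext fun j => LOf_row θ r j
  rw [h1, Perm.sign_one, one_mul]
  simp only [h2, Perm.sign_mul]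
  have h3 : ∀ r : ZMod p, Perm.sign (sh r) * Perm.sign (rowBase θ) * Perm.sign (sh (-r)) =
      -Perm.sign θ.perm := by
    intro r
    rw [mul_assoc, mul_left_comm, sign_sh_mul_sign_sh_neg, mul_one, sign_rowBase]
  simp only [h3, Finset.prod_const, Finset.card_univ, ZMod.card, Int.units_pow_eq_pow_mod_two,
    Nat.odd_iff.mp hodd, pow_one]

/-- **Lemma 6 (columns)**: `ε_C(L_θ) = −sgn(θ − id)·sgn(x ↦ −x)`. [cite: Drisko1997, Lemmas 6–7] -/
theorem colSignG_LOf (hodd : Odd p) (h : IsLatinG (LOf θ)) :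
    colSignG (LOf θ) h = -(Perm.sign θ.eta * Perm.sign (Equiv.neg (ZMod p))) := by
  rw [colSignG, Fintype.prod_option]
  have h1 : (Equiv.ofBijective (fun i => LOf θ i none) (h.2 none) : Perm (Idx p)) = 1 :=
    Equiv.ext fun i => by cases i <;> rfl
  have h2 : ∀ x : ZMod p, (Equiv.ofBijective (fun i => LOf θ i (some x)) (h.2 (some x)) :
      Perm (Idx p)) = sh x * colBase θ * sh (-x) := fun x => Equiv.ext fun i => LOf_col θ x i
  rw [h1, Perm.sign_one, one_mul]
  simp only [h2, Perm.sign_mul]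
  have h3 : ∀ x : ZMod p, Perm.sign (sh x) * Perm.sign (colBase θ) * Perm.sign (sh (-x)) =
      -(Perm.sign θ.eta * Perm.sign (Equiv.neg (ZMod p))) := by
    intro x
    rw [mul_assoc, mul_left_comm, sign_sh_mul_sign_sh_neg, mul_one, sign_colBase]
  simp only [h3, Finset.prod_const, Finset.card_univ, ZMod.card, Int.units_pow_eq_pow_mod_two,
    Nat.odd_iff.mp hodd, pow_one]

/-- **Lemmas 6–7 combined**: `ε(L_θ) = sgn θ · sgn(θ − id) · sgn(x ↦ −x)`.
[cite: Drisko1997, Lemmas 6–7] -/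
theorem signG_LOf (hodd : Odd p) :
    signG (LOf θ) = ((Perm.sign θ.perm * Perm.sign θ.eta : ℤˣ) : ℤ) *
      ((Perm.sign (Equiv.neg (ZMod p)) : ℤˣ) : ℤ) := by
  rw [signG_of (isLatinG_LOf θ), rowSignG_LOf θ hodd, colSignG_LOf θ hodd, neg_mul_neg,
    ← Units.val_mul, mul_assoc]

/-- `L_θ` is fixed by the diagonal translations `(k, k, k)` (the automorphism `(π,π,π)` of the
neofield loop). [cite: Drisko1997, Lemma 3 (proof, first paragraph)] -/
theorem act_diag_LOf (k : ZMod p) : act (k, k, k) (LOf θ) = LOf θ := by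
  rw [act_eq_self_iff]
  intro i j
  cases i with
  | none => simp
  | some r =>
    cases j with
    | none => simp
    | some x =>
      simp only [sh_some, LOf_some_some, add_left_inj, add_sub_add_right_eq_sub]
      by_cases hx : x = r
      · rw [if_pos hx, if_pos hx, sh_none]
      · rw [if_neg hx, if_neg hx, sh_some, add_assoc]

/-- `2 ≠ 0` in `ℤ_p` for odd `p`. [folklore] -/
private theorem two_ne_zero_zmod (hodd : Odd p) : (2 : ZMod p) ≠ 0 := by
  intro h
  have hdvd : p ∣ 2 := (ZMod.natCast_eq_zero_iff 2 p).mp (by exact_mod_cast h)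
  have hle : p ≤ 2 := Nat.le_of_dvd two_pos hdvd
  have hge : 2 ≤ p := hp.out.two_le
  have hp2 : p = 2 := le_antisymm hle hge
  rw [hp2] at hodd
  exact absurd hodd (by decide)

/-- Sums of all elements of `ℤ_p` vanish for odd `p`. [folklore] -/
private theorem sum_id_zmod_eq_zero (hodd : Odd p) : ∑ x : ZMod p, x = 0 := by
  have h2 : (2 : ZMod p) ≠ 0 := two_ne_zero_zmod hodd
  have hs : ∑ x : ZMod p, -x = ∑ x : ZMod p, x :=
    Equiv.sum_comp (Equiv.neg (ZMod p)) (fun x => x)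
  rw [Finset.sum_neg_distrib] at hs
  have h2s : (2 : ZMod p) * ∑ x : ZMod p, x = 0 := by
    rw [two_mul]
    nth_rewrite 1 [← hs]
    exact neg_add_cancel _
  rcases mul_eq_zero.mp h2s with h | h
  · exact absurd h h2
  · exact h

/-- **The normalised squares of `Fix(1,1,1)` are the `L_θ`** (Drisko's Lemmas 3–4: a Latin square
of order `p+1` with the diagonal shift as autotopism, row `∞`/column `∞` through `(0,∞) ↦ 0` and
`∞` at `(0,0)`, is the table of an orthomorphism; "`x₀ = e`" by the sum argument of Lemma 4).
[cite: Drisko1997, Lemma 3 and Lemma 4] -/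
theorem exists_eq_LOf (hodd : Odd p) {N : Idx p → Idx p → Idx p} (hN : IsLatinG N)
    (K : ∀ (k : ZMod p) (i j : Idx p), sh k (N i j) = N (sh k i) (sh k j))
    (h0 : N (some 0) none = some 0) (h1 : N (some 0) (some 0) = none) :
    ∃ θ : Orth p, N = LOf θ := by
  -- `N ∞ ∞ = ∞`
  have hnn : N none none = none := by
    have h := K 1 none none
    rw [sh_none] at h
    rcases (sh_eq_self_iff 1 _).mp h with h' | h'
    · exact absurd h' one_ne_zero
    · exact h'
  -- transport of rows and of the row `∞`
  have hrow : ∀ (r : ZMod p) (j : Idx p), N (some r) j = sh r (N (some 0) (sh (-r) j)) := by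
    intro r j
    rw [K r, sh_some, zero_add, sh_sh, neg_add_cancel, sh_zero_apply]
  have htop : ∀ x : ZMod p, N none (some x) = sh x (N none (some 0)) := by
    intro x
    rw [K x, sh_none, sh_some, zero_add]
  -- `θ`
  set θf : ZMod p → ZMod p := fun x => (N (some 0) (some x)).getD 0 with hθf
  have hθ0 : θf 0 = 0 := by simp [hθf, h1]
  have hθsome : ∀ x, x ≠ 0 → N (some 0) (some x) = some (θf x) := by
    intro x hx
    cases hN0 : N (some 0) (some x) with
    | none =>
      exact absurd (Option.some_injective _ ((hN.1 (some 0)).injective (hN0.trans h1.symm))) hx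
    | some y => simp [hθf, hN0]
  have hθne : ∀ x, x ≠ 0 → θf x ≠ 0 := by
    intro x hx h
    have e : N (some 0) (some x) = N (some 0) none := by rw [hθsome x hx, h, h0]
    exact Option.some_ne_none x ((hN.1 (some 0)).injective e)
  have hθinj : Function.Injective θf := by
    intro x x' hxx'
    by_cases hx : x = 0
    · by_cases hx' : x' = 0
      · rw [hx, hx']
      · exfalso
        exact hθne x' hx' (by rw [← hxx', hx, hθ0])
    · by_cases hx' : x' = 0
      · exfalso
        exact hθne x hx (by rw [hxx', hx', hθ0])
      · have e : N (some 0) (some x) = N (some 0) (some x') := by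
          rw [hθsome x hx, hθsome x' hx', hxx']
        exact Option.some_injective _ ((hN.1 (some 0)).injective e)
  have hθbij : Function.Bijective θf := Finite.injective_iff_bijective.mp hθinj
  set θ : Perm (ZMod p) := Equiv.ofBijective θf hθbij with hθ
  -- `η = θ − id`, the column `0` and the sum argument
  set ηf : ZMod p → ZMod p := fun x => θf x - x with hηf
  have hcol0 : ∀ r : ZMod p, r ≠ 0 → N (some r) (some 0) = some (ηf (-r)) := by
    intro r hr
    rw [hrow r, sh_some, zero_add, hθsome (-r) (neg_ne_zero.mpr hr), sh_some]
    simp only [hηf, sub_neg_eq_add]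
  obtain ⟨u, hu⟩ : ∃ u, N none (some 0) = some u := by
    cases hN0 : N none (some 0) with
    | none => exact absurd ((hN.2 (some 0)).injective (hN0.trans h1.symm)) (by simp)
    | some u => exact ⟨u, rfl⟩
  have hηinj' : ∀ d d', d ≠ 0 → d' ≠ 0 → ηf d = ηf d' → d = d' := by
    intro d d' hd hd' h
    have e1 := hcol0 (-d) (neg_ne_zero.mpr hd)
    have e2 := hcol0 (-d') (neg_ne_zero.mpr hd')
    rw [neg_neg] at e1 e2
    have e := (hN.2 (some 0)).injective (e1.trans ((congrArg some h).trans e2.symm))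
    exact neg_injective (Option.some_injective _ e)
  have hηu : ∀ d, d ≠ 0 → ηf d ≠ u := by
    intro d hd h
    have e1 := hcol0 (-d) (neg_ne_zero.mpr hd)
    rw [neg_neg, h, ← hu] at e1
    exact Option.some_ne_none _ ((hN.2 (some 0)).injective e1)
  have hu0 : u = 0 := by
    have hinjOn : Set.InjOn ηf (nz p : Finset (ZMod p)) := fun d hd d' hd' h =>
      hηinj' d d' (mem_nz.mp hd) (mem_nz.mp hd') h
    have hTsub : (nz p).image ηf ⊆ univ.erase u := by
      intro y hy
      obtain ⟨d, hd, rfl⟩ := Finset.mem_image.mp hy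
      exact Finset.mem_erase.mpr ⟨hηu d (mem_nz.mp hd), mem_univ _⟩
    have hTcard : ((nz p).image ηf).card = p - 1 := by
      rw [Finset.card_image_of_injOn hinjOn, card_nz]
    have hT : (nz p).image ηf = univ.erase u :=
      Finset.eq_of_subset_of_card_le hTsub
        (by rw [Finset.card_erase_of_mem (mem_univ _), card_univ, ZMod.card, hTcard])
    have hsum1 : ∑ y ∈ (nz p).image ηf, y = -u := by
      rw [hT, Finset.sum_erase_eq_sub (mem_univ _), sum_id_zmod_eq_zero hodd, zero_sub]
    have hsum2 : ∑ y ∈ (nz p).image ηf, y = 0 := by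
      rw [Finset.sum_image hinjOn]
      simp only [hηf, Finset.sum_sub_distrib]
      have e1 : ∑ d ∈ nz p, θf d = ∑ d : ZMod p, d := by
        rw [nz, Finset.filter_ne', Finset.sum_erase_eq_sub (mem_univ _), hθ0, sub_zero]
        exact Equiv.sum_comp θ (fun x => x)
      have e2 : ∑ d ∈ nz p, d = ∑ d : ZMod p, d := by
        rw [nz, Finset.filter_ne', Finset.sum_erase_eq_sub (mem_univ _), sub_zero]
      rw [e1, e2, sub_self]
    exact neg_eq_zero.mp (hsum1.symm.trans hsum2)
  -- `η` is a permutation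
  have hη0 : ηf 0 = 0 := by simp [hηf, hθ0]
  have hηne : ∀ d, d ≠ 0 → ηf d ≠ 0 := fun d hd => hu0 ▸ hηu d hd
  have hηinj : Function.Injective ηf := by
    intro d d' h
    by_cases hd : d = 0
    · by_cases hd' : d' = 0
      · rw [hd, hd']
      · exfalso
        exact hηne d' hd' (by rw [← h, hd, hη0])
    · by_cases hd' : d' = 0
      · exfalso
        exact hηne d hd (by rw [h, hd', hη0])
      · exact hηinj' d d' hd hd' h
  set η : Perm (ZMod p) := Equiv.ofBijective ηf (Finite.injective_iff_bijective.mp hηinj) with hη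
  refine ⟨⟨(θ, η), hθ0, fun x => rfl⟩, ?_⟩
  -- `N = L_θ`
  funext i j
  cases i with
  | none =>
    cases j with
    | none => rw [hnn]; rfl
    | some x => rw [htop x, hu, hu0, sh_some, zero_add]; rfl
  | some r =>
    cases j with
    | none => rw [hrow, sh_none, h0, sh_some, zero_add]; rfl
    | some x =>
      rw [hrow, sh_some, LOf_some_some]
      by_cases hx : x = r
      · rw [if_pos hx, hx, add_neg_cancel, h1, sh_none]
      · have hxr : x + -r ≠ 0 := by rwa [← sub_eq_add_neg, sub_ne_zero]
        rw [if_neg hx, hθsome _ hxr, sh_some, ← sub_eq_add_neg]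
        rfl

/-- **`Fix(1,1,1) = {(0,w,v) · L_θ}`**: every Latin square fixed by the diagonal translation is a
translate of the table of an orthomorphism. [cite: Drisko1997, Lemma 3] -/
theorem exists_eq_act_LOf (hodd : Odd p) {M : Idx p → Idx p → Idx p} (hM : IsLatinG M)
    (hfix : act ((1 : ZMod p), 1, 1) M = M) :
    ∃ (b c : ZMod p) (θ : Orth p), act ((0 : ZMod p), b, c) (LOf θ) = M := by
  have K : ∀ (k : ZMod p) (i j : Idx p), sh k (M i j) = M (sh k i) (sh k j) := by
    intro k
    have h := act_smul_eq_self hfix k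
    have hk : k • ((1 : ZMod p), (1 : ZMod p), (1 : ZMod p)) = (k, k, k) := by ext <;> simp
    rw [hk, act_eq_self_iff] at h
    exact h
  have hnn : M none none = none := by
    have h := K 1 none none
    rw [sh_none] at h
    rcases (sh_eq_self_iff 1 _).mp h with h' | h'
    · exact absurd h' one_ne_zero
    · exact h'
  obtain ⟨v, hv⟩ : ∃ v, M (some 0) none = some v := by
    cases h : M (some 0) none with
    | none => exact absurd ((hM.2 none).injective (h.trans hnn.symm)) (by simp)
    | some v => exact ⟨v, rfl⟩
  obtain ⟨w, hw⟩ : ∃ w, M (some 0) (some w) = none := by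
    obtain ⟨j, hj⟩ := (hM.1 (some 0)).surjective none
    cases j with
    | none => rw [hv] at hj; exact absurd hj (by simp)
    | some w => exact ⟨w, hj⟩
  set N := act ((0 : ZMod p), -w, -v) M with hN
  have hNlat : IsLatinG N := (isLatinG_act_iff _ _).mpr hM
  have KN : ∀ (k : ZMod p) (i j : Idx p), sh k (N i j) = N (sh k i) (sh k j) := by
    intro k
    have h : act (k, k, k) N = N := by
      rw [hN, act_comm, (act_eq_self_iff (k, k, k) M).mpr (K k)]
    exact (act_eq_self_iff _ _).mp h
  have hN0 : N (some 0) none = some 0 := by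
    rw [hN, act_apply]
    simp [hv]
  have hN1 : N (some 0) (some 0) = none := by
    rw [hN, act_apply]
    simp [hw]
  obtain ⟨θ, hθ⟩ := exists_eq_LOf hodd hNlat KN hN0 hN1
  refine ⟨w, v, θ, ?_⟩
  rw [← hθ, hN, ← act_add]
  have h0 : ((0 : ZMod p), w, v) + ((0 : ZMod p), -w, -v) = 0 := by ext <;> simp
  rw [h0, act_zero]

/-- The parametrisation `(b, c, θ) ↦ (0,b,c) · L_θ` of `Fix(1,1,1)`. [cite: Drisko1997, Lemma 3] -/
def param (t : ZMod p × ZMod p × Orth p) : Idx p → Idx p → Idx p :=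
  act ((0 : ZMod p), t.1, t.2.1) (LOf t.2.2)

/-- The parametrisation `(b, c, θ) ↦ (0,b,c) · L_θ` is injective (the position of `∞` in row `0` and the entry at `(0, ∞)` recover `b, c`). [cite: Drisko1997, Lemma 3] -/
theorem param_injective : Function.Injective (param (p := p)) := by
  rintro ⟨b, c, θ⟩ ⟨b', c', θ'⟩ h
  simp only [param] at h
  have hc : c = c' := by
    have h1 := congrFun (congrFun h (some 0)) none
    simpa [act_apply] using h1
  have hb : b = b' := by
    by_contra hbb
    have h1 := congrFun (congrFun h (some 0)) (some b)
    have e1 : act ((0 : ZMod p), b, c) (LOf θ) (some 0) (some b) = none := by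
      rw [act_apply, neg_zero, sh_zero_apply, sh_some, add_neg_cancel, LOf_some_some, if_pos rfl,
        sh_none]
    have e2 : act ((0 : ZMod p), b', c') (LOf θ') (some 0) (some b) ≠ none := by
      rw [act_apply, neg_zero, sh_zero_apply, sh_some, LOf_some_some, if_neg ?_, sh_some]
      · exact Option.some_ne_none _
      · show ¬ b + -b' = 0
        rwa [← sub_eq_add_neg, sub_eq_zero]
    rw [e1] at h1
    exact e2 h1.symm
  subst hc hb
  have hL : LOf θ = LOf θ' := act_injective _ h
  have hθ : θ = θ' := by
    refine Orth.ext' fun x => ?_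
    by_cases hx : x = 0
    · rw [hx, θ.perm_zero, θ'.perm_zero]
    · have h1 := congrFun (congrFun hL (some 0)) (some x)
      rw [LOf_some_some, LOf_some_some, if_neg hx, if_neg hx, sub_zero, add_zero, add_zero] at h1
      exact Option.some_injective _ h1
  rw [hθ]

/-- `Fix(1,1,1)` is the image of the parametrisation iff the parametrisation is onto it. [cite: Drisko1997, Lemma 3] -/
theorem fixSet_one_eq_image :
    fixSet ((1 : ZMod p), 1, 1) = (univ : Finset (ZMod p × ZMod p × Orth p)).image param ↔
      ∀ M, M ∈ fixSet ((1 : ZMod p), 1, 1) → ∃ t, param t = M := by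
  constructor
  · intro h M hM
    rw [h] at hM
    obtain ⟨t, -, ht⟩ := Finset.mem_image.mp hM
    exact ⟨t, ht⟩
  · intro h
    ext M
    rw [Finset.mem_image]
    constructor
    · intro hM
      obtain ⟨t, ht⟩ := h M hM
      exact ⟨t, mem_univ _, ht⟩
    · rintro ⟨t, -, rfl⟩
      rw [mem_fixSet, param]
      refine ⟨(isLatinG_act_iff _ _).mpr (isLatinG_LOf _), ?_⟩
      rw [act_comm, act_diag_LOf]

/-- **Drisko's Thm. 5 (core)**: `Σ_{Fix(1,1,1)} ε = p² Σ_θ ε(L_θ)`. [cite: Drisko1997, Thm. 5] -/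
theorem sum_fixSet_one (hodd : Odd p) :
    ∑ M ∈ fixSet ((1 : ZMod p), 1, 1), signG M = (p : ℤ) ^ 2 * ∑ θ : Orth p, signG (LOf θ) := by
  have himg : fixSet ((1 : ZMod p), 1, 1) =
      (univ : Finset (ZMod p × ZMod p × Orth p)).image param := by
    rw [fixSet_one_eq_image]
    intro M hM
    rw [mem_fixSet] at hM
    obtain ⟨b, c, θ, h⟩ := exists_eq_act_LOf hodd hM.1 hM.2
    exact ⟨(b, c, θ), h⟩
  rw [himg, Finset.sum_image fun t _ t' _ h => param_injective h]
  have h1 : ∀ t : ZMod p × ZMod p × Orth p, signG (param t) = signG (LOf t.2.2) :=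
    fun t => signG_act hodd _ _
  simp only [h1]
  rw [Fintype.sum_prod_type, Finset.sum_congr rfl fun b _ => Fintype.sum_prod_type (γ := ℤ)
    (f := fun t : ZMod p × Orth p => signG (LOf t.2))]
  simp only [Finset.sum_const, Finset.card_univ, ZMod.card]
  ring

end Orth

/-! ### Drisko's Lemma 8: `Σ_θ sgn θ · sgn(θ − id) ≡ −1 (mod p)` via the `T_g`-action -/

section LemmaEight

variable {p : ℕ} [hp : Fact p.Prime]

/-- Translations of `ℤ_p` are even permutations (`p` odd: a `p`-cycle or the identity).
[cite: Drisko1997, Lemma 8 (proof: "`α_h` is the identity if `h = 0` and a `p`-cycle otherwise")] -/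
theorem sign_addRight (hodd : Odd p) (k : ZMod p) : Perm.sign (Equiv.addRight k) = 1 := by
  set σ : Perm (ZMod p) := Equiv.addRight k with hσ
  have hiter : ∀ n : ℕ, ∀ x, (σ ^ n) x = x + n • k := by
    intro n
    induction n with
    | zero => intro x; simp
    | succ n ih =>
      intro x
      rw [pow_succ, Perm.mul_apply]
      change (σ ^ n) (x + k) = _
      rw [ih, succ_nsmul, add_assoc, add_comm k]
  have hpow : σ ^ p = 1 := Equiv.ext fun x => by
    rw [hiter, Perm.one_apply, nsmul_eq_mul, ZMod.natCast_self, zero_mul, add_zero]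
  have hs : Perm.sign (σ ^ p) = 1 := by rw [hpow, Perm.sign_one]
  rw [map_pow] at hs
  rcases Int.units_eq_one_or (Perm.sign σ) with h | h
  · exact h
  · rw [h, hodd.neg_one_pow] at hs
    exact absurd hs (by decide)

/-- `x ↦ θ(x + g) − s` as a permutation. [cite: Drisko1997, Lemma 8 (proof)] -/
def tPerm (g s : ZMod p) (θ : Perm (ZMod p)) : Perm (ZMod p) :=
  (Equiv.addRight g).trans (θ.trans (Equiv.addRight (-s)))

/-- Unfolding of `tPerm`. [cite: Drisko1997, Lemma 8 (proof)] -/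
@[simp] theorem tPerm_apply (g s : ZMod p) (θ : Perm (ZMod p)) (x : ZMod p) :
    tPerm g s θ x = θ (x + g) - s := by
  simp [tPerm, sub_eq_add_neg]

/-- `x ↦ θ(x + g) − s` has the sign of `θ` (translations are even). [cite: Drisko1997, Lemma 8 (proof)] -/
theorem sign_tPerm (hodd : Odd p) (g s : ZMod p) (θ : Perm (ZMod p)) :
    Perm.sign (tPerm g s θ) = Perm.sign θ := by
  rw [tPerm, Perm.sign_trans, Perm.sign_trans, sign_addRight hodd, sign_addRight hodd, one_mul,
    mul_one]

/-- **Drisko's maps `T_g`** on orthomorphisms: `θ T_g = (i ↦ θ(i + g) − θ(g))` (again an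
orthomorphism, with `θT_g − id = (i ↦ (θ − id)(i + g) − (θ − id)(g))`). [cite: Drisko1997, Lemma 8 (proof)] -/
def tAct (g : ZMod p) (θ : Orth p) : Orth p :=
  ⟨(tPerm g (θ.perm g) θ.perm, tPerm g (θ.eta g) θ.eta), by
    refine ⟨?_, fun x => ?_⟩
    · show tPerm g (θ.perm g) θ.perm 0 = 0
      rw [tPerm_apply, zero_add, sub_self]
    · show tPerm g (θ.eta g) θ.eta x = tPerm g (θ.perm g) θ.perm x - x
      rw [tPerm_apply, tPerm_apply, θ.eta_apply, θ.eta_apply]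
      ring⟩

/-- The permutation of `θ T_g`. [cite: Drisko1997, Lemma 8 (proof)] -/
theorem tAct_perm (g : ZMod p) (θ : Orth p) : (tAct g θ).perm = tPerm g (θ.perm g) θ.perm := rfl

/-- The permutation `θ T_g − id`. [cite: Drisko1997, Lemma 8 (proof)] -/
theorem tAct_eta (g : ZMod p) (θ : Orth p) : (tAct g θ).eta = tPerm g (θ.eta g) θ.eta := rfl

/-- `(θ T_g)(x) = θ(x + g) − θ(g)`. [cite: Drisko1997, Lemma 8 (proof)] -/
theorem tAct_perm_apply (g : ZMod p) (θ : Orth p) (x : ZMod p) :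
    (tAct g θ).perm x = θ.perm (x + g) - θ.perm g := by
  rw [tAct_perm, tPerm_apply]

/-- `T_0 = id`. [cite: Drisko1997, Lemma 8 (proof)] -/
theorem tAct_zero (θ : Orth p) : tAct 0 θ = θ :=
  Orth.ext' fun x => by rw [tAct_perm_apply, add_zero, θ.perm_zero, sub_zero]

/-- `T_g T_h = T_{g+h}`. [cite: Drisko1997, Lemma 8 (proof)] -/
theorem tAct_add (g h : ZMod p) (θ : Orth p) : tAct (g + h) θ = tAct g (tAct h θ) :=
  Orth.ext' fun x => by
    rw [tAct_perm_apply, tAct_perm_apply, tAct_perm_apply, tAct_perm_apply, ← add_assoc]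
    ring

/-- The weight `sgn θ · sgn(θ − id)` (`= ε(θ) ε(θ^{rc}) ε(μ_{−1}) = ε(L_θ) ε(μ_{−1})`). [cite: Drisko1997, Lemma 7 (eq. (20))] -/
def weight (θ : Orth p) : ℤ := ((Perm.sign θ.perm * Perm.sign θ.eta : ℤˣ) : ℤ)

/-- The weight is `T_g`-invariant ("`T_g` is a sign preserving map"). [cite: Drisko1997, Lemma 8 (proof)] -/
theorem weight_tAct (hodd : Odd p) (g : ZMod p) (θ : Orth p) : weight (tAct g θ) = weight θ := by
  unfold weight
  rw [tAct_perm, tAct_eta, sign_tPerm hodd, sign_tPerm hodd]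

/-- The orthomorphisms "multiplication by `a`" (`θ(x) = x·θ(1)`). [cite: Drisko1997, Lemma 8 (the `θ_a`)] -/
def IsMul (θ : Orth p) : Prop := ∀ x, θ.perm x = x * θ.perm 1

/-- Being a multiplication is decidable. [cite: Drisko1997, Lemma 8 (the orthomorphisms `θ_a`, `a ≠ 0, 1`, and eq. (21))] -/
instance isMul_decidable : DecidablePred (IsMul (p := p)) := fun θ => by
  unfold IsMul; infer_instance

/-- A `T_g`-fixed orthomorphism, `g ≠ 0`, is additive, hence a multiplication ("θ is a
homomorphism, but as a permutation of `ℤ_p` it must be an automorphism"). [cite: Drisko1997, Lemma 8 (proof)] -/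
theorem isMul_of_tAct_eq {g : ZMod p} {θ : Orth p} (hg : g ≠ 0) (h : tAct g θ = θ) : IsMul θ := by
  have hadd1 : ∀ x, θ.perm (x + g) = θ.perm x + θ.perm g := by
    intro x
    have e := congrArg (fun φ : Orth p => φ.perm x) h
    simp only [tAct_perm_apply] at e
    exact sub_eq_iff_eq_add.mp e
  have haddn : ∀ (n : ℕ) (x : ZMod p), θ.perm (x + n • g) = θ.perm x + n • θ.perm g := by
    intro n
    induction n with
    | zero => intro x; simp
    | succ n ih => intro x; rw [succ_nsmul, ← add_assoc, hadd1, ih, succ_nsmul, add_assoc]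
  have hall : ∀ x y, θ.perm (x + y) = θ.perm x + θ.perm y := by
    intro x y
    have hy : y = ((y * g⁻¹).val : ℕ) • g := by
      rw [nsmul_eq_mul, ZMod.natCast_zmod_val, inv_mul_cancel_right₀ hg]
    have h0 : θ.perm y = ((y * g⁻¹).val : ℕ) • θ.perm g := by
      have e := haddn ((y * g⁻¹).val) 0
      rw [zero_add, θ.perm_zero, zero_add, ← hy] at e
      exact e
    have e := haddn ((y * g⁻¹).val) x
    rw [← hy] at e
    rw [e, h0]
  have key : ∀ n : ℕ, θ.perm (n • (1 : ZMod p)) = n • θ.perm 1 := by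
    intro n
    induction n with
    | zero => simp [θ.perm_zero]
    | succ n ih => rw [succ_nsmul, hall, ih, succ_nsmul]
  intro x
  have hx : x = (x.val : ℕ) • (1 : ZMod p) := by
    rw [nsmul_eq_mul, mul_one, ZMod.natCast_zmod_val]
  calc θ.perm x = θ.perm ((x.val : ℕ) • (1 : ZMod p)) := by rw [← hx]
    _ = (x.val : ℕ) • θ.perm 1 := key _
    _ = x * θ.perm 1 := by rw [nsmul_eq_mul, ZMod.natCast_zmod_val]

/-- The multiplications are `T_g`-stable (indeed fixed). [cite: Drisko1997, Lemma 8 (proof)] -/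
theorem IsMul.tAct {θ : Orth p} (h : IsMul θ) (g : ZMod p) : IsMul (tAct g θ) := by
  intro x
  rw [tAct_perm_apply, tAct_perm_apply, h (x + g), h g, h (1 + g)]
  ring

/-- The free part of `Σ_θ sgn θ sgn(θ − id)` is divisible by `p` (orbits of size `p`).
[cite: Drisko1997, Lemma 8 (proof: "every orbit … has order `p`, except for the singleton orbits `θ_a`")] -/
theorem dvd_sum_weight_not_isMul (hodd : Odd p) :
    (p : ℤ) ∣ ∑ θ ∈ (univ : Finset (Orth p)).filter (fun θ => ¬ IsMul θ), weight θ := by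
  have h := card_dvd_sum_of_free (G := ZMod p) tAct tAct_zero tAct_add weight (weight_tAct hodd)
    ((univ : Finset (Orth p)).filter fun θ => ¬ IsMul θ) ?_ ?_
  · rwa [ZMod.card] at h
  · intro g θ hθ
    rw [Finset.mem_filter] at hθ ⊢
    refine ⟨mem_univ _, fun hm => hθ.2 ?_⟩
    have e := hm.tAct (-g)
    rwa [← tAct_add, neg_add_cancel, tAct_zero] at e
  · intro g θ hθ hfix
    by_contra hg
    exact (Finset.mem_filter.mp hθ).2 (isMul_of_tAct_eq hg hfix)

/-! #### The multiplications and the character `χ(a) = sgn(x ↦ a x)` -/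

/-- The unit `u` acts on `ℤ_p` by `x ↦ u x`. [folklore] -/
private theorem toPermHom_apply_eq (u : (ZMod p)ˣ) (x : ZMod p) :
    MulAction.toPermHom (ZMod p)ˣ (ZMod p) u x = (u : ZMod p) * x := by
  simp [MulAction.toPerm_apply, Units.smul_def]

/-- `χ(a) = sgn(x ↦ a·x)` for `a ≠ 0`, extended by `0`. [cite: Drisko1997, Lemma 8 ("`ε(θ_a)`")] -/
def mulSign (a : ZMod p) : ℤ :=
  if h : a = 0 then 0
  else ((Perm.sign (MulAction.toPermHom (ZMod p)ˣ (ZMod p) (Units.mk0 a h)) : ℤˣ) : ℤ)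

/-- Unfolding of `χ` at `a ≠ 0`. [cite: Drisko1997, Lemma 8 (the orthomorphisms `θ_a`, `a ≠ 0, 1`, and eq. (21))] -/
theorem mulSign_of_ne {a : ZMod p} (h : a ≠ 0) :
    mulSign a = ((Perm.sign (MulAction.toPermHom (ZMod p)ˣ (ZMod p) (Units.mk0 a h)) : ℤˣ) : ℤ) :=
  dif_neg h

/-- `χ` is multiplicative (`θ_{ab} = θ_a θ_b`). [cite: Drisko1997, Lemma 8 (the orthomorphisms `θ_a`, `a ≠ 0, 1`, and eq. (21))] -/
theorem mulSign_mul {a b : ZMod p} (ha : a ≠ 0) (hb : b ≠ 0) :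
    mulSign (a * b) = mulSign a * mulSign b := by
  rw [mulSign_of_ne (mul_ne_zero ha hb), mulSign_of_ne ha, mulSign_of_ne hb, ← Units.val_mul,
    ← Perm.sign_mul, ← map_mul, ← Units.mk0_mul]

/-- `χ(a)² = 1`. [cite: Drisko1997, Lemma 8 (the orthomorphisms `θ_a`, `a ≠ 0, 1`, and eq. (21))] -/
theorem mulSign_mul_self {a : ZMod p} (ha : a ≠ 0) : mulSign a * mulSign a = 1 := by
  rw [mulSign_of_ne ha, ← Units.val_mul, Int.units_mul_self, Units.val_one]

/-- `χ(1) = 1`. [cite: Drisko1997, Lemma 8 (the orthomorphisms `θ_a`, `a ≠ 0, 1`, and eq. (21))] -/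
theorem mulSign_one : mulSign (1 : ZMod p) = 1 := by
  rw [mulSign_of_ne one_ne_zero]
  have h1 : Units.mk0 (1 : ZMod p) one_ne_zero = 1 := Units.ext rfl
  rw [h1, map_one, Perm.sign_one, Units.val_one]

/-- For a multiplication orthomorphism `θ = θ_a` (`a = θ(1) ≠ 0, 1`) the weight is
`χ(a) χ(a − 1)` (`θ_a − id = θ_{a−1}`). [cite: Drisko1997, Lemma 8 (the orthomorphisms `θ_a`)] -/
theorem weight_of_isMul {θ : Orth p} (h : IsMul θ) :
    weight θ = mulSign (θ.perm 1) * mulSign (θ.perm 1 - 1) := by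
  have ha : θ.perm 1 ≠ 0 := θ.perm_ne_zero one_ne_zero
  have ha1 : θ.perm 1 - 1 ≠ 0 := by rw [← θ.eta_apply]; exact θ.eta_ne_zero one_ne_zero
  have e1 : θ.perm = MulAction.toPermHom (ZMod p)ˣ (ZMod p) (Units.mk0 _ ha) :=
    Equiv.ext fun x => by rw [toPermHom_apply_eq, Units.val_mk0, h x, mul_comm]
  have e2 : θ.eta = MulAction.toPermHom (ZMod p)ˣ (ZMod p) (Units.mk0 _ ha1) :=
    Equiv.ext fun x => by rw [toPermHom_apply_eq, Units.val_mk0, θ.eta_apply, h x]; ring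
  rw [weight, Units.val_mul, mulSign_of_ne ha, mulSign_of_ne ha1, ← e1, ← e2]

/-- The multiplication orthomorphism `θ_a`, `a ≠ 0, 1`. [cite: Drisko1997, Lemma 8] -/
def mulOrth (a : ZMod p) (ha : a ≠ 0) (ha1 : a ≠ 1) : Orth p :=
  ⟨(MulAction.toPermHom (ZMod p)ˣ (ZMod p) (Units.mk0 a ha),
    MulAction.toPermHom (ZMod p)ˣ (ZMod p) (Units.mk0 (a - 1) (sub_ne_zero.mpr ha1))), by
    refine ⟨?_, fun x => ?_⟩
    · show MulAction.toPermHom (ZMod p)ˣ (ZMod p) (Units.mk0 a ha) 0 = 0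
      rw [toPermHom_apply_eq, mul_zero]
    · show MulAction.toPermHom (ZMod p)ˣ (ZMod p) (Units.mk0 (a - 1) (sub_ne_zero.mpr ha1)) x =
        MulAction.toPermHom (ZMod p)ˣ (ZMod p) (Units.mk0 a ha) x - x
      rw [toPermHom_apply_eq, toPermHom_apply_eq, Units.val_mk0, Units.val_mk0]
      ring⟩

/-- `θ_a(x) = a x`. [cite: Drisko1997, Lemma 8 (the orthomorphisms `θ_a`, `a ≠ 0, 1`, and eq. (21))] -/
theorem mulOrth_perm_apply (a : ZMod p) (ha : a ≠ 0) (ha1 : a ≠ 1) (x : ZMod p) :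
    (mulOrth a ha ha1).perm x = a * x := by
  show MulAction.toPermHom (ZMod p)ˣ (ZMod p) (Units.mk0 a ha) x = a * x
  rw [toPermHom_apply_eq, Units.val_mk0]

/-- `ℤ_p ∖ {0, 1}`. [cite: Drisko1997, Lemma 8 (the orthomorphisms `θ_a`, `a ≠ 0, 1`, and eq. (21))] -/
def nzo (p : ℕ) [Fact p.Prime] : Finset (ZMod p) := univ.filter fun a => a ≠ 0 ∧ a ≠ 1

/-- Membership in `ℤ_p ∖ {0, 1}`. [cite: Drisko1997, Lemma 8 (the orthomorphisms `θ_a`, `a ≠ 0, 1`, and eq. (21))] -/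
theorem mem_nzo {a : ZMod p} : a ∈ nzo p ↔ a ≠ 0 ∧ a ≠ 1 := by simp [nzo]

/-- The fixed part: `Σ_{θ = θ_a} sgn θ sgn(θ − id) = Σ_{a ≠ 0,1} χ(a) χ(a−1)`.
[cite: Drisko1997, Lemma 8 (eq. (21))] -/
theorem sum_weight_isMul :
    ∑ θ ∈ (univ : Finset (Orth p)).filter IsMul, weight θ =
      ∑ a ∈ nzo p, mulSign a * mulSign (a - 1) := by
  refine Finset.sum_bij (fun θ _ => θ.perm 1) ?_ ?_ ?_ ?_
  · intro θ _
    rw [mem_nzo]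
    refine ⟨θ.perm_ne_zero one_ne_zero, fun h1 => ?_⟩
    exact θ.eta_ne_zero one_ne_zero (by rw [θ.eta_apply, h1, sub_self])
  · intro θ hθ θ' hθ' h
    rw [Finset.mem_filter] at hθ hθ'
    exact Orth.ext' fun x => by rw [hθ.2 x, hθ'.2 x, h]
  · intro a ha
    rw [mem_nzo] at ha
    refine ⟨mulOrth a ha.1 ha.2, ?_, ?_⟩
    · rw [Finset.mem_filter]
      refine ⟨mem_univ _, fun x => ?_⟩
      rw [mulOrth_perm_apply, mulOrth_perm_apply, mul_one, mul_comm]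
    · rw [mulOrth_perm_apply, mul_one]
  · intro θ hθ
    exact weight_of_isMul (Finset.mem_filter.mp hθ).2

/-- A generator of `ℤ_p^*` acts on `ℤ_p` as a `(p−1)`-cycle, so `χ` takes the value `−1`.
[cite: Drisko1997, Lemma 8 (proof: "`θ_a` is a `(p−1)`-cycle")] -/
theorem exists_sign_toPermHom_eq_neg_one (hodd : Odd p) :
    ∃ u : (ZMod p)ˣ, Perm.sign (MulAction.toPermHom (ZMod p)ˣ (ZMod p) u) = -1 := by
  obtain ⟨g, hg⟩ := IsCyclic.exists_generator (α := (ZMod p)ˣ)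
  refine ⟨g, ?_⟩
  set σ : Perm (ZMod p) := MulAction.toPermHom (ZMod p)ˣ (ZMod p) g with hσ
  have hσapp : ∀ x, σ x = (g : ZMod p) * x := fun x => toPermHom_apply_eq g x
  have hg1 : (g : ZMod p) ≠ 1 := by
    intro h1
    have hgone : g = 1 := Units.ext h1
    obtain ⟨k, hk⟩ := Subgroup.mem_zpowers_iff.mp (hg (-1))
    rw [hgone, one_zpow] at hk
    have h2 : ((1 : (ZMod p)ˣ) : ZMod p) = ((-1 : (ZMod p)ˣ) : ZMod p) := congrArg Units.val hk
    rw [Units.val_one, Units.val_neg, Units.val_one] at h2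
    exact two_ne_zero_zmod hodd (by linear_combination h2)
  have hsupp : σ.support = univ.erase 0 := by
    ext x
    rw [Perm.mem_support, hσapp, Finset.mem_erase, and_iff_left (mem_univ _)]
    constructor
    · intro h hx
      apply h
      rw [hx, mul_zero]
    · intro hx h
      apply hg1
      have e : ((g : ZMod p) - 1) * x = 0 := by rw [sub_mul, one_mul, h, sub_self]
      rcases mul_eq_zero.mp e with h' | h'
      · exact sub_eq_zero.mp h'
      · exact absurd h' hx
  have hcycle : σ.IsCycle := by
    refine ⟨1, ?_, fun y hy => ?_⟩
    · rw [hσapp, mul_one]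
      exact hg1
    · have hy0 : y ≠ 0 := by
        intro h0
        apply hy
        rw [h0, hσapp, mul_zero]
      obtain ⟨k, hk⟩ := Subgroup.mem_zpowers_iff.mp (hg (Units.mk0 y hy0))
      refine ⟨k, ?_⟩
      rw [hσ, ← map_zpow, toPermHom_apply_eq, hk, Units.val_mk0, mul_one]
  rw [hcycle.sign, hsupp, Finset.card_erase_of_mem (mem_univ _), Finset.card_univ, ZMod.card,
    (Nat.Odd.sub_odd hodd odd_one).neg_one_pow]

/-- The character `χ : ℤ_p^* → {±1} ⊆ ℤ`, `χ(u) = sgn(x ↦ u x)`. [cite: Drisko1997, Lemma 8 (the orthomorphisms `θ_a`, `a ≠ 0, 1`, and eq. (21))] -/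
def chi (p : ℕ) [Fact p.Prime] : (ZMod p)ˣ →* ℤ :=
  (Units.coeHom ℤ).comp (Perm.sign.comp (MulAction.toPermHom (ZMod p)ˣ (ZMod p)))

/-- Unfolding of `χ`. [cite: Drisko1997, Lemma 8 (the orthomorphisms `θ_a`, `a ≠ 0, 1`, and eq. (21))] -/
theorem chi_apply (u : (ZMod p)ˣ) :
    chi p u = ((Perm.sign (MulAction.toPermHom (ZMod p)ˣ (ZMod p) u) : ℤˣ) : ℤ) := rfl

/-- `Σ_{u ∈ ℤ_p^*} χ(u) = 0` (`χ` is a nontrivial character). [cite: Drisko1997, Lemma 8 (eq. (21): `Σ_{i=1}^{p−2} (−1)^i = −1`)] -/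
theorem sum_chi_eq_zero (hodd : Odd p) : ∑ u : (ZMod p)ˣ, chi p u = 0 := by
  apply sum_hom_units_eq_zero
  obtain ⟨u, hu⟩ := exists_sign_toPermHom_eq_neg_one hodd (p := p)
  intro h
  have e := DFunLike.congr_fun h u
  rw [chi_apply, hu, MonoidHom.one_apply, Units.val_neg, Units.val_one] at e
  exact absurd e (by decide)

/-- `Σ_{a ≠ 0} χ(a) = 0`. [cite: Drisko1997, Lemma 8 (eq. (21))] -/
theorem sum_mulSign_nz (hodd : Odd p) : ∑ a ∈ nz p, mulSign a = 0 := by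
  rw [← sum_chi_eq_zero hodd (p := p)]
  symm
  refine Finset.sum_nbij' (fun u : (ZMod p)ˣ => (u : ZMod p))
    (fun a => if h : a = 0 then 1 else Units.mk0 a h) ?_ ?_ ?_ ?_ ?_
  · intro u _
    exact mem_nz.mpr u.ne_zero
  · intro a _
    exact mem_univ _
  · intro u _
    simp only [Units.ne_zero, ↓reduceDIte, Units.mk0_val]
  · intro a ha
    rw [mem_nz] at ha
    simp only [ha, ↓reduceDIte, Units.val_mk0]
  · intro u _
    rw [chi_apply, mulSign_of_ne u.ne_zero]
    simp only [Units.mk0_val]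

/-- **The character sum** `Σ_{a ≠ 0,1} χ(a)χ(a − 1) = Σ_{b ≠ 0,1} χ(b) = −1`
(substitute `b = 1 − a⁻¹`). [cite: Drisko1997, Lemma 8 (eq. (21))] -/
theorem sum_mulSign_mul_eq (hodd : Odd p) : ∑ a ∈ nzo p, mulSign a * mulSign (a - 1) = -1 := by
  -- `χ(a)χ(a−1) = χ(1 − a⁻¹)`
  have h1 : ∀ a ∈ nzo p, mulSign a * mulSign (a - 1) = mulSign (1 - a⁻¹) := by
    intro a ha
    rw [mem_nzo] at ha
    have hb : 1 - a⁻¹ ≠ 0 := by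
      rw [sub_ne_zero, ne_comm, Ne, inv_eq_one]
      exact ha.2
    have e : a - 1 = a * (1 - a⁻¹) := by rw [mul_sub, mul_one, mul_inv_cancel₀ ha.1]
    rw [e, mulSign_mul ha.1 hb, ← mul_assoc, mulSign_mul_self ha.1, one_mul]
  rw [Finset.sum_congr rfl h1]
  -- reindex `b = 1 − a⁻¹`
  have h2 : ∑ a ∈ nzo p, mulSign (1 - a⁻¹) = ∑ b ∈ nzo p, mulSign b := by
    refine Finset.sum_nbij' (fun a => 1 - a⁻¹) (fun b => (1 - b)⁻¹) ?_ ?_ ?_ ?_ ?_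
    · intro a ha
      rw [mem_nzo] at ha ⊢
      refine ⟨?_, ?_⟩
      · rw [sub_ne_zero, ne_comm, Ne, inv_eq_one]
        exact ha.2
      · rw [Ne, sub_eq_self, inv_eq_zero]
        exact ha.1
    · intro b hb
      rw [mem_nzo] at hb ⊢
      refine ⟨inv_ne_zero (sub_ne_zero.mpr (Ne.symm hb.2)), ?_⟩
      rw [Ne, inv_eq_one, sub_eq_self]
      exact hb.1
    · intro a _
      simp only [sub_sub_cancel, inv_inv]
    · intro b _
      simp only [inv_inv, sub_sub_cancel]
    · intro a _
      rfl
  rw [h2]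
  -- `Σ_{b ≠ 0,1} χ(b) = Σ_{b ≠ 0} χ(b) − χ(1) = −1`
  have h3 : nzo p = (nz p).erase 1 := by
    ext a
    rw [mem_nzo, Finset.mem_erase, mem_nz]
    tauto
  rw [h3, Finset.sum_erase_eq_sub (mem_nz.mpr one_ne_zero), sum_mulSign_nz hodd, mulSign_one,
    zero_sub]

/-- **Drisko's Lemma 8** (for the weight `sgn θ · sgn(θ − id)`): the sum over all orthomorphisms
is `≡ −1 (mod p)`. [cite: Drisko1997, Lemma 8] -/
theorem sum_weight_eq (hodd : Odd p) : ∃ k : ℤ, ∑ θ : Orth p, weight θ = -1 + p * k := by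
  obtain ⟨k, hk⟩ := dvd_sum_weight_not_isMul hodd (p := p)
  refine ⟨k, ?_⟩
  rw [← Finset.sum_filter_add_sum_filter_not (univ : Finset (Orth p)) IsMul weight,
    sum_weight_isMul, sum_mulSign_mul_eq hodd, hk]

end LemmaEight

/-! ### Assembly: Theorem 5 + Lemmas 6–8 ⇒ Theorem 9 -/

section Assembly

variable {p : ℕ} [hp : Fact p.Prime]

/-- **Drisko's count modulo `p³`**: `Σ_L ε(L) = −sgn(x ↦ −x)·p² + p³ k` over the Latin squares on
`ℤ_p ⊔ {∞}`. [cite: Drisko1997, Thm. 5 and Thm. 9 (proof, eq. (22))] -/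
theorem drisko_atCount (hodd : Odd p) : ∃ k : ℤ,
    atCount (Idx p) = -(((Perm.sign (Equiv.neg (ZMod p)) : ℤˣ) : ℤ) * (p : ℤ) ^ 2) +
      (p : ℤ) ^ 3 * k := by
  obtain ⟨k1, hk1⟩ := pow_three_dvd_sum_freeSet hodd (p := p)
  obtain ⟨k2, hk2⟩ := sum_weight_eq hodd (p := p)
  set s : ℤ := ((Perm.sign (Equiv.neg (ZMod p)) : ℤˣ) : ℤ) with hs
  have hS : ∑ θ : Orth p, signG (LOf θ) = s * ∑ θ : Orth p, weight θ := by
    rw [Finset.mul_sum]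
    refine Finset.sum_congr rfl fun θ _ => ?_
    rw [signG_LOf θ hodd, weight, mul_comm]
  have hsym : ∑ M ∈ symSet p, signG M =
      ((p - 1 : ℕ) : ℤ) ^ 2 * ((p : ℤ) ^ 2 * (s * (-1 + p * k2))) := by
    have hc : ∀ bc ∈ nz p ×ˢ nz p, ∑ M ∈ fixSet ((1 : ZMod p), bc.1, bc.2), signG M =
        ∑ M ∈ fixSet ((1 : ZMod p), 1, 1), signG M := by
      intro bc hbc
      rw [Finset.mem_product, mem_nz, mem_nz] at hbc
      exact sum_fixSet_eq_sum_fixSet_one hodd hbc.1 hbc.2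
    rw [sum_symSet_eq, Finset.sum_congr rfl hc, Finset.sum_const, Finset.card_product, card_nz,
      sum_fixSet_one hodd, hS, hk2, nsmul_eq_mul]
    push_cast
    ring
  refine ⟨k1 + ((p : ℤ) - 1) ^ 2 * s * k2 - s * ((p : ℤ) - 2), ?_⟩
  rw [atCount_idx_eq, hk1, hsym, Nat.cast_sub hp.out.one_le, Nat.cast_one]
  ring

/-- The signed count for `Fin (p+1)` is the one for `ℤ_p ⊔ {∞}`. [cite: Drisko1997, §3 (`n = p + 1`, symbol set `{e, 0, 1, …, p−1}`)] -/
theorem atCount_fin_succ_eq : atCount (Fin (p + 1)) = atCount (Idx p) := by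
  haveI : NeZero p := ⟨hp.out.ne_zero⟩
  exact atCount_congr (finSuccEquivLast.trans (Equiv.optionCongr (ZMod.finEquiv p).toEquiv))

/-- `sgn(x ↦ −x)` on `ℤ_p` is `(−1)^{(p−1)/2}` — "the permutation `μ_{−1}` consists of `(p−1)/2`
transpositions". [cite: Drisko1997, Lemma 7 (proof)] -/
theorem sign_neg_zmod (hodd : Odd p) :
    ((Perm.sign (Equiv.neg (ZMod p)) : ℤˣ) : ℤ) = (-1) ^ ((p - 1) / 2) := by
  classical
  set τ : Perm (ZMod p) := Equiv.neg (ZMod p) with hτ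
  have hsupp : τ.support = univ.erase 0 := by
    ext x
    rw [Perm.mem_support, Finset.mem_erase, and_iff_left (mem_univ _), hτ, Equiv.neg_apply, Ne,
      neg_eq_iff_add_eq_zero, ← two_mul, mul_eq_zero, not_or]
    exact ⟨fun h => h.2, fun h => ⟨two_ne_zero_zmod hodd, h⟩⟩
  have hcard : τ.support.card = p - 1 := by
    rw [hsupp, Finset.card_erase_of_mem (mem_univ _), Finset.card_univ, ZMod.card]
  have h2 : τ ^ 2 = 1 := by
    ext x
    simp [hτ, pow_two]
  have hne : τ ≠ 1 := by
    intro h1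
    have h := hcard
    rw [h1, Perm.support_one, Finset.card_empty] at h
    have := hp.out.two_le
    omega
  have hord : orderOf τ = 2 := orderOf_eq_prime h2 hne
  obtain ⟨k, hk⟩ := Perm.cycleType_prime_order (σ := τ) (by rw [hord]; exact Nat.prime_two)
  rw [hord] at hk
  have hsum := Perm.sum_cycleType τ
  rw [hk, Multiset.sum_replicate, smul_eq_mul, hcard] at hsum
  rw [Perm.sign_of_cycleType, hk, Multiset.sum_replicate, Multiset.card_replicate, smul_eq_mul,
    Units.val_pow_eq_pow_val, Units.val_neg, Units.val_one]
  have hk2 : (p - 1) / 2 = k + 1 := by omega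
  rw [hk2, pow_add, pow_mul', neg_one_sq, one_pow, one_mul]

/-- **Discharge of `Drisko1997_AlonTarsi`** [Drisko1997, abstract: "given an odd prime `p`, the
number of even latin squares of order `p+1` is not equal to the number of odd latin squares of order
`p+1`"]: for every odd prime `p`, `AlonTarsiConjecture (p + 1)`. [cite: Drisko1997, Thm. 9] -/
theorem Drisko1997_AlonTarsi_holds : Drisko1997_AlonTarsi := by
  intro p hpr hodd
  haveI : Fact p.Prime := ⟨hpr⟩
  unfold AlonTarsiConjecture
  rw [← atCount_fin, atCount_fin_succ_eq]
  obtain ⟨k, hk⟩ := drisko_atCount hodd (p := p)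
  rw [hk]
  intro h0
  set s : ℤ := ((Perm.sign (Equiv.neg (ZMod p)) : ℤˣ) : ℤ) with hs
  have hs1 : s = 1 ∨ s = -1 := by
    rcases Int.units_eq_one_or (Perm.sign (Equiv.neg (ZMod p))) with h | h
    · left
      rw [hs, h, Units.val_one]
    · right
      rw [hs, h, Units.val_neg, Units.val_one]
  have hp0 : (p : ℤ) ≠ 0 := by exact_mod_cast hpr.ne_zero
  have hdvd : (p : ℤ) ∣ s := by
    refine ⟨k, ?_⟩
    have e : (p : ℤ) ^ 2 * (p * k - s) = 0 := by linear_combination h0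
    rcases mul_eq_zero.mp e with h | h
    · exact absurd (pow_eq_zero_iff two_ne_zero |>.mp h) hp0
    · linear_combination -h
  have hdvd1 : (p : ℤ) ∣ 1 := by
    rcases hs1 with h | h
    · rwa [h] at hdvd
    · rw [h] at hdvd
      exact dvd_neg.mp hdvd
  have h1 : p ∣ 1 := by exact_mod_cast hdvd1
  exact hpr.one_lt.ne' (Nat.dvd_one.mp h1)

open scoped Classical in
/-- **Drisko's Thm. 9 as printed**: "Let `p` be an odd prime and `n = p+1`. Then the number of even
latin squares of order `n` minus the number of odd latin squares of order `n` is congruent modulo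
`p³` to `(−1)^{(p+1)/2} p²`." (even/odd = the tree's `latinSign = ±1`, the signed count being the
sum defining `AlonTarsiConjecture (p + 1)`). [cite: Drisko1997, Thm. 9] -/
theorem drisko1997_thm_9 {p : ℕ} (hpr : p.Prime) (hodd : Odd p) :
    (∑ L : {L : Fin (p + 1) → Fin (p + 1) → Fin (p + 1) // IsLatinSquare L},
        ((latinSign L.1 L.2 : ℤˣ) : ℤ)) ≡ (-1) ^ ((p + 1) / 2) * (p : ℤ) ^ 2 [ZMOD (p : ℤ) ^ 3] := by
  haveI : Fact p.Prime := ⟨hpr⟩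
  rw [← atCount_fin, atCount_fin_succ_eq]
  obtain ⟨k, hk⟩ := drisko_atCount hodd (p := p)
  rw [hk, sign_neg_zmod hodd]
  have e : (p + 1) / 2 = (p - 1) / 2 + 1 := by
    obtain ⟨m, rfl⟩ := hodd
    omega
  rw [e, pow_succ, Int.modEq_iff_dvd]
  exact ⟨-k, by ring⟩

/-- **Kumar's stretching theorem is unconditional in dimension `p + 1`** (`p` an odd prime): for
every partition `λ` with at most `p + 1` parts, `(p+1)·λ ∈ S(Det_{p+1})` — `kumar_stretching_prime_add_one`
fed with `Kumar2015_stretching_holds` and `Drisko1997_AlonTarsi_holds`.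
[cite: BurgisserHuttenhainIkenmeyer2017, Thm. 2 (Kumar)] [cite: Drisko1997, Thm. 9] -/
theorem kumar_stretching_prime_add_one_holds {p : ℕ} (hpr : p.Prime) (hodd : Odd p) (D : ℕ)
    (lam : Nat.Partition D) (hlen : lam.parts.card ≤ p + 1) :
    (p + 1) • Weight.ofPartition ((p + 1) * (p + 1)) lam ∈ detOccWeights (p + 1) :=
  kumar_stretching_prime_add_one Kumar2015_stretching_holds Drisko1997_AlonTarsi_holds hpr hodd D
    lam hlen

/-- **The Alon–Tarsi conjecture holds unconditionally for every even `2 ≤ m ≤ 24`** (all of the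
form `p ± 1`; Glynn, Cor. 3.4: "The smallest unsolved case … is 26") — `alonTarsi_of_even_le_24` fed
with the two discharges. [cite: Glynn2010AlonTarsi, Cor. 3.4] [cite: Drisko1997, Thm. 9] -/
theorem alonTarsi_of_even_le_24_holds {m : ℕ} (hm : Even m) (h2 : 2 ≤ m) (h24 : m ≤ 24) :
    AlonTarsiConjecture m :=
  alonTarsi_of_even_le_24 Drisko1997_AlonTarsi_holds Glynn2010_AlonTarsi_holds hm h2 h24

end Assembly

end Literature.Barriers.ValiantsHypothesis
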